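import Mathlib
import Literature.NumberTheory.LFunctions.Zhang2022.SkeletonPartOneB
import Literature.NumberTheory.LFunctions.Zhang2022.Section5VerticalShift
import Literature.NumberTheory.LFunctions.Zhang2022.Section5Lemma51
import Literature.NumberTheory.LFunctions.Zhang2022.Section5Lemma52Holds
import HarnessLib

/-!
# Zhang (2022), TYPED STATEMENTS §5A: Lemmas 5.1–5.2 with their proofs' displayed steps, the
# reflection formula for `ϑ`, (5.5), `ϑ*`, `Δ₁` (5.6), `Δ` (5.7) and the positivity of `ω(1/2+2πix)`
# (arXiv:2211.02515v1, §5 pp. 24–25, tex L1314–L1400; DAG nodes `Z22:Lem5.1` … `Z22:§5.u012`)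

Topic `Literature/NumberTheory/LFunctions/Zhang2022` (Landau–Siegel audit tree; verdict-neutral).
Y. Zhang, *Discrete mean estimates and the Landau–Siegel zero*, arXiv:2211.02515v1 (2022)
[Zhang2022LandauSiegel] — **an unrefereed manuscript under adjudication. Every `def … : Prop` below
is a CLAIM OF THE MANUSCRIPT (one per DAG node), STATED NOT ASSERTED; a `…_holds` theorem next to a
node means that node is DISCHARGED in the kernel from theorems already in the tree. Nothing here
asserts or denies Theorems 1–2 of the manuscript.** (Cell siegel-zhang, D-0069 statement layer L1,
file plan `plan/FILES.tsv` row `TypedSection05A.lean`, seat L1-t8.)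

Conventions (skeleton INTERFACE §3): `𝓛 = ell D = log D`, `P = bigP D = exp 𝓛⁹` (2.6), `α = alpha D
= π/log P` (2.10), `t₀ = t0 D = 𝓛⁵¹⁹`, `𝓛₁ = ell1 D = 𝓛⁴⁰⁵` (2.8), `𝓛₂ = ell2 D = 𝓛⁴⁰⁰` (2.15); `Ψ` =
`Chr D` (a prime `p ∼ P`, i.e. `P < p < P(1+𝓛⁻⁶⁸)`, with a primitive `ψ mod p`); `Z(s,ψ)` =
`GammaFactor.Zfac x.ψ s`, `Z(s,ψχ)` = `Skeleton.Zpc χ x s`, `Y(s,ψ)` = `Skeleton.Yroot x.ψ s` (`Y² = Z⁻¹`),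
`β₁,β₂,β₃` = `Skeleton.beta1/2/3 c' D` (2.13) with the unspecified constant `c′`; `ϑ` =
`GammaFactor.vartheta` (2.3), `ϑ*(1−s)` = `GammaFactor.varthetaStarOneSub s`, `ω` = `Skeleton.omegaW D`
(2.15). "`X ≪ Y`" ↦ `∃ C, ForAllLarge (… ‖X‖ ≤ C·Y)`; "`X = Y(1+O(R))`" ↦ `‖X − Y‖ ≤ C·R·‖Y‖`;
"`X = Y + O(R)`" ↦ `‖X − Y‖ ≤ C·R`. The standing range of Lemmas 5.1–5.2 (`|σ − 1/2| ≤ α`,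
`|t − 2πt₀| < 𝓛₁ + 2`) is the banked predicate `Skeleton.InRange51 D s`; `w = u + iv` with `u = 0` is
`w = v * I`; the printed bound "`|v| < Ł²⁰`" (tex `\L^{20}`, an undefined macro rendering as `Ł`) is read
`|v| < 𝓛²⁰` as in §4 p. 17 / §6 (the range of `ω₁(iv)`), exactly as the banked node `Skeleton.Lemma51`.

| DAG node | decl | kind | status here |
|---|---|---|---|
| `Z22:Lem5.1` | `Lem5_1` := `Skeleton.Lemma51` | Lemma (banked p403321) | referenced; `lemma51_iff` |
| `Z22:(5.1)`–`(5.4)` | `Eq5_1` … `Eq5_4` | displays | typed; `lemma51_iff : Lemma51 ↔ Eq5_1 ∧ … ∧ Eq5_4` PROVED |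
| `Z22:Lem5.1.pf` | `Lem5_1_pf` (+ `Lem5_1_pf'`, `lem5_1_pf_of`) | proof node | typed (deduction `u001 → u002 → u003 → u004 → Lemma51`) |
| `Z22:§5.u001` | `Sec5_u001` | step | typed; **DISCHARGED** `sec5_u001_holds` (tree `eq_mul_exp_I_mul_integral_logDeriv`) |
| `Z22:§5.u002` | `Sec5_u002a`, `Sec5_u002b` (+ `Sec5_u002b'`) | step | typed; `sec5_u002a_holds` DISCHARGED; `u002b` see CAVEAT |
| `Z22:§5.u003` | `Sec5_u003` (+ `Sec5_u003'`) | step | typed; see CAVEAT |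
| `Z22:§5.u004` | `Sec5_u004` | step | typed; **DISCHARGED** `sec5_u004_holds` |
| `Z22:Lem5.2`, `Z22:§5.u005` | `Lem5_2`, `Sec5_u005` := `Skeleton.Lemma52` | Lemma (banked) | referenced |
| `Z22:Lem5.2.pf` | `Lem5_2_pf` | proof node | typed (deduction `u006 → u007 → u008 → u009 → Lemma52`) |
| `Z22:§5.u006` | `Sec5_u006` | step | typed; **DISCHARGED** `sec5_u006_holds` (`Y² = Z⁻¹`) |
| `Z22:§5.u007` | `Sec5_u007a`, `Sec5_u007b` | step | typed; `sec5_u007a_holds` DISCHARGED |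
| `Z22:§5.u008` | `Sec5_u008a`, `Sec5_u008b` | step | typed |
| `Z22:§5.u009` | `Sec5_u009` | step | typed; **DISCHARGED** `sec5_u009_holds` (`ring`) |
| `Z22:§5.u010` | `Sec5_u010` | step ("It is known that") | typed; **DISCHARGED** (tree `GammaFactor.vartheta_one_sub`) |
| `Z22:(5.5)` | `Eq5_5` | display | typed; **DISCHARGED** `eq5_5_holds` (tree `vartheta_one_sub_eq_star_mul`, constant `1`) |
| `Z22:§5.u011` | `Sec5_u011` (object `GammaFactor.varthetaStarOneSub`) | step-def | typed; **DISCHARGED** (`e(−s/4) = exp(−πis/2)`) |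
| `Z22:(5.6)` | `DeltaOneW`, `Eq5_6` | display (def) | object = tree `Lemma53.Delta1_56` at `(𝓛₂,t₀)`; `eq5_6_holds` (rfl) |
| `Z22:(5.7)` | `Eq5_7` (object `Skeleton.DeltaW`) | display (def) | **DISCHARGED** `eq5_7_holds` (rfl) |
| `Z22:§5.u012` | `Sec5_u012` | step | typed; **DISCHARGED** (tree `SmoothWeight.omega_half_eq`, `omegaLine_pos`) |

CAVEAT (typer's reading, recorded for the adjudication, not a verdict). In the proof of Lemma 5.1 the
manuscript writes, for `|w′| ≤ |w|` (`|w| < 𝓛²⁰`), "`Z′/Z(s+w′,ψ) = … = −log(pt/2π) + O(1/t₀)`" and "Hence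
`Z(s+w,ψ) = Z(s,ψ)(pt/2π)^{−w} + O(|w|/t₀)`" with `t = Im s` fixed by the hypothesis `|t − 2πt₀| < 𝓛₁ + 2`.
Read with an absolute implied constant uniformly in `|w′| < 𝓛²⁰`, the first needs `log((t+v′)/t) = O(1/t₀)`,
which fails by the factor `|v′|` (`𝓛²⁰/(2π𝓛⁵¹⁹)` against `𝓛⁻⁵¹⁹`), and the second inherits the factor `|w|`
(the true discrepancy is `≍ |Z(s,ψ)|·v²/(2t)`). The tree's kernel form of this step
(`GammaFactor.Zfac_vertical_shift`, file `Section5VerticalShift`) carries exactly the extra factor: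
`Z(s+iv,θ) = Z(s,θ)(kt/2π)^{−iv}(1 + O((|v|+A)|v|/t))`. Both displays are therefore typed twice: AS PRINTED
(`Sec5_u002b`, `Sec5_u003`) and in the corrected form the tree proves (`Sec5_u002b'`, `Sec5_u003'`, bridges
`sec5_u002b'_of`, `sec5_u003'_of` from the printed ones). The conclusions (5.1)–(5.4) are NOT affected: they
ask only for `≪ |w|𝓛⁻¹¹⁴` (resp. `|w|𝓛⁻⁶⁸`), and `|w|²/t₀ ≤ |w|𝓛⁻⁴⁹⁹`.

## References

* Y. Zhang, arXiv:2211.02515v1 (2022), §5 pp. 24–25: Lemma 5.1, (5.1)–(5.4) and proof; Lemma 5.2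
  and proof; the reflection formula for `ϑ`, (5.5), `ϑ*`; (5.6), (5.7); the Note before Lemma 5.3.
  [cite: Zhang2022LandauSiegel, §5 pp. 24–25]
* E. C. Titchmarsh, *The Theory of the Riemann Zeta-Function* (2nd ed., 1986), §2.1 (2.1.10):
  `χ(1−s) = 2(2π)^{−s}Γ(s)cos(πs/2)` (the "It is known that" before (5.5)).
  [cite: Titchmarsh1986, §2.1 (2.1.10)]
-/

noncomputable section

open Complex Real

namespace Literature.NumberTheory.LFunctions.Zhang2022.Typed

open Literature.NumberTheory.LFunctions.Zhang2022.Skeleton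

/-! ## Lemma 5.1 and the displays (5.1)–(5.4) -/

/-- **Lemma 5.1** (DAG `Z22:Lem5.1`): "Suppose `ψ (mod p) ∈ Ψ`, `|σ − 1/2| ≤ α`, `|t − 2πt₀| < 𝓛₁ + 2`,
`u = 0` and `|v| < 𝓛²⁰`. Then (5.1), (5.2), (5.3) and (5.4)." This IS the banked skeleton node
`Skeleton.Lemma51` (p403321), referenced here, not restated; the four displays are typed separately
below and `lemma51_iff` is the kernel bridge. [cite: Zhang2022LandauSiegel, Lemma 5.1 p.24] -/
abbrev Lem5_1 : Prop := Skeleton.Lemma51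

/-- **(5.1)** (DAG `Z22:(5.1)`), under the hypotheses of Lemma 5.1 (`w = iv`, `v ≠ 0` for the quotient):
"`(Z(s+w,ψ) − Z(s,ψ)(pt₀)^{−w})/w ≪ 𝓛⁻¹¹⁴`". CLAIM (first conjunct of `Skeleton.Lemma51`).
[cite: Zhang2022LandauSiegel, (5.1) p.24] -/
def Eq5_1 : Prop :=
  ∃ C : ℝ, ForAllLarge fun D _ _ => ∀ x : Chr D, ∀ s : ℂ, InRange51 D s → ∀ v : ℝ, v ≠ 0 →
    |v| < ell D ^ 20 →
      ‖(GammaFactor.Zfac x.ψ (s + v * I) -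
          GammaFactor.Zfac x.ψ s * (((x.p : ℝ) * t0 D : ℝ) : ℂ) ^ (-(v * I))) / (v * I)‖
        ≤ C * (ell D ^ 114)⁻¹

/-- **(5.2)** (DAG `Z22:(5.2)`): "`(Z(s+w,ψ) − Z(s,ψ)(Pt₀)^{−w})/w ≪ 𝓛⁻⁶⁸`" (same hypotheses).
CLAIM (second conjunct of `Skeleton.Lemma51`). [cite: Zhang2022LandauSiegel, (5.2) p.24] -/
def Eq5_2 : Prop :=
  ∃ C : ℝ, ForAllLarge fun D _ _ => ∀ x : Chr D, ∀ s : ℂ, InRange51 D s → ∀ v : ℝ, v ≠ 0 →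
    |v| < ell D ^ 20 →
      ‖(GammaFactor.Zfac x.ψ (s + v * I) -
          GammaFactor.Zfac x.ψ s * ((bigP D * t0 D : ℝ) : ℂ) ^ (-(v * I))) / (v * I)‖
        ≤ C * (ell D ^ 68)⁻¹

/-- **(5.3)** (DAG `Z22:(5.3)`): "`(Z(s+w,ψχ) − Z(s,ψχ)(Dpt₀)^{−w})/w ≪ 𝓛⁻¹¹⁴`" (same hypotheses;
`ψχ` primitive mod `Dp`, `Z(s,ψχ) = Skeleton.Zpc χ x s`). CLAIM (third conjunct of `Skeleton.Lemma51`).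
[cite: Zhang2022LandauSiegel, (5.3) p.24] -/
def Eq5_3 : Prop :=
  ∃ C : ℝ, ForAllLarge fun D _ χ => ∀ x : Chr D, ∀ s : ℂ, InRange51 D s → ∀ v : ℝ, v ≠ 0 →
    |v| < ell D ^ 20 →
      ‖(Zpc χ x (s + v * I) - Zpc χ x s * (((D : ℝ) * x.p * t0 D : ℝ) : ℂ) ^ (-(v * I))) / (v * I)‖
        ≤ C * (ell D ^ 114)⁻¹

/-- **(5.4)** (DAG `Z22:(5.4)`): "`(Z(s+w,ψχ) − Z(s,ψχ)(DPt₀)^{−w})/w ≪ 𝓛⁻⁶⁸`" (same hypotheses).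
CLAIM (fourth conjunct of `Skeleton.Lemma51`). [cite: Zhang2022LandauSiegel, (5.4) p.24] -/
def Eq5_4 : Prop :=
  ∃ C : ℝ, ForAllLarge fun D _ χ => ∀ x : Chr D, ∀ s : ℂ, InRange51 D s → ∀ v : ℝ, v ≠ 0 →
    |v| < ell D ^ 20 →
      ‖(Zpc χ x (s + v * I) - Zpc χ x s * (((D : ℝ) * bigP D * t0 D : ℝ) : ℂ) ^ (-(v * I))) /
          (v * I)‖ ≤ C * (ell D ^ 68)⁻¹

/-- `𝓛⁻ᵏ ≥ 0` (`𝓛 = log D ≥ 0` for a natural number `D`). [folklore] -/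
private theorem ell_pow_inv_nonneg (D k : ℕ) : 0 ≤ (ell D ^ k)⁻¹ :=
  inv_nonneg.mpr (pow_nonneg (Real.log_natCast_nonneg D) k)

/-- **Bridge `Z22:Lem5.1` ↔ (5.1) ∧ (5.2) ∧ (5.3) ∧ (5.4)**: the banked node `Skeleton.Lemma51` is exactly
the conjunction of the four typed displays (one implied constant ↔ four: take the maximum, and the larger
`D₀`). [cite: Zhang2022LandauSiegel, Lemma 5.1 p.24] -/
theorem lemma51_iff : Skeleton.Lemma51 ↔ Eq5_1 ∧ Eq5_2 ∧ Eq5_3 ∧ Eq5_4 := by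
  constructor
  · rintro ⟨C, h⟩
    refine ⟨⟨C, h.mono fun D _ χ _ _ h x s hs v hv hv' => (h x s hs v hv hv').1⟩,
      ⟨C, h.mono fun D _ χ _ _ h x s hs v hv hv' => (h x s hs v hv hv').2.1⟩,
      ⟨C, h.mono fun D _ χ _ _ h x s hs v hv hv' => (h x s hs v hv hv').2.2.1⟩,
      ⟨C, h.mono fun D _ χ _ _ h x s hs v hv hv' => (h x s hs v hv hv').2.2.2⟩⟩
  · rintro ⟨⟨C₁, h₁⟩, ⟨C₂, h₂⟩, ⟨C₃, h₃⟩, ⟨C₄, h₄⟩⟩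
    set M : ℝ := max (max C₁ C₂) (max C₃ C₄) with hM
    have hC₁ : C₁ ≤ M := (le_max_left C₁ C₂).trans (le_max_left _ _)
    have hC₂ : C₂ ≤ M := (le_max_right C₁ C₂).trans (le_max_left _ _)
    have hC₃ : C₃ ≤ M := (le_max_left C₃ C₄).trans (le_max_right _ _)
    have hC₄ : C₄ ≤ M := (le_max_right C₃ C₄).trans (le_max_right _ _)
    refine ⟨M, (((h₁.and h₂).and h₃).and h₄).mono fun D _ χ _ _ h x s hs v hv hv' => ?_⟩
    obtain ⟨⟨⟨g₁, g₂⟩, g₃⟩, g₄⟩ := h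
    have e114 := ell_pow_inv_nonneg D 114
    have e68 := ell_pow_inv_nonneg D 68
    exact ⟨(g₁ x s hs v hv hv').trans (mul_le_mul_of_nonneg_right hC₁ e114),
      (g₂ x s hs v hv hv').trans (mul_le_mul_of_nonneg_right hC₂ e68),
      (g₃ x s hs v hv hv').trans (mul_le_mul_of_nonneg_right hC₃ e114),
      (g₄ x s hs v hv hv').trans (mul_le_mul_of_nonneg_right hC₄ e68)⟩

/-! ## The proof of Lemma 5.1 (p. 24): steps `§5.u001`–`§5.u004` -/

/-- **`Z22:§5.u001`** (proof of Lemma 5.1, first display): "We have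
`Z(s+w,ψ)/Z(s,ψ) = exp{∫₀^w (Z′/Z)(s+w′,ψ) dw′}`" — for `ψ ∈ Ψ`, `s` in the range of Lemma 5.1 and
`w = iv`, `|v| < 𝓛²⁰`; the path is the vertical segment `w′ = iy`, `dw′ = i dy`. CLAIM.
[cite: Zhang2022LandauSiegel, §5.u001 p.24] -/
def Sec5_u001 : Prop :=
  ForAllLarge fun D _ _ => ∀ x : Chr D, ∀ s : ℂ, InRange51 D s → ∀ v : ℝ, |v| < ell D ^ 20 →
    GammaFactor.Zfac x.ψ (s + v * I) / GammaFactor.Zfac x.ψ s =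
      Complex.exp (I * ∫ y : ℝ in (0 : ℝ)..v,
        deriv (GammaFactor.Zfac x.ψ) (s + y * I) / GammaFactor.Zfac x.ψ (s + y * I))

/-- **`Z22:§5.u002`, first equality** (proof of Lemma 5.1): "Assume `|w′| ≤ |w|`. By (2.6) and the
Stirling formula, `(Z′/Z)(s+w′,ψ) = −log p + (ϑ′/ϑ)(s+w′) + O(ε)`", `ε = exp{−c𝓛¹⁰}` (§4 p. 20) — typed
for all `w′ = iv′`, `|v′| < 𝓛²⁰` (equivalent to "`|w′| ≤ |w|` for some admissible `w`"). CLAIM.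
[cite: Zhang2022LandauSiegel, §5.u002 p.24] -/
def Sec5_u002a : Prop :=
  ∃ c : ℝ, 0 < c ∧ ∃ C : ℝ, ForAllLarge fun D _ _ => ∀ x : Chr D, ∀ s : ℂ, InRange51 D s →
    ∀ v' : ℝ, |v'| < ell D ^ 20 →
      ‖logDeriv (GammaFactor.Zfac x.ψ) (s + v' * I) -
          (-(Real.log x.p : ℂ) + logDeriv GammaFactor.vartheta (s + v' * I))‖
        ≤ C * Real.exp (-c * ell D ^ 10)

/-- **`Z22:§5.u002`, second equality, AS PRINTED**: "`… = −log(pt/2π) + O(1/t₀)`" with `t = Im s` (fixed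
by the hypothesis of Lemma 5.1) and an absolute implied constant, for all `w′ = iv′`, `|v′| < 𝓛²⁰`.
CLAIM — see the module CAVEAT: in this reading the display does not follow (the discrepancy
`log((t+v′)/t)` is of size `|v′|/t`, not `O(1/t₀)`); the derivable form is `Sec5_u002b'`.
[cite: Zhang2022LandauSiegel, §5.u002 p.24] -/
def Sec5_u002b : Prop :=
  ∃ C : ℝ, ForAllLarge fun D _ _ => ∀ x : Chr D, ∀ s : ℂ, InRange51 D s →
    ∀ v' : ℝ, |v'| < ell D ^ 20 →
      ‖logDeriv (GammaFactor.Zfac x.ψ) (s + v' * I) + Real.log (x.p * s.im / (2 * π))‖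
        ≤ C * (t0 D)⁻¹

/-- **`Z22:§5.u002`, second equality, CORRECTED READING** (typer's variant, INTERFACE §4): the same
with the error `O((1 + |v′|)/t₀)` — the form the tree's `GammaFactor.norm_logDeriv_vartheta_add_log_le`
(Stirling) + `GammaFactor.logDeriv_Zfac_eq` yield, and all that (5.1)–(5.2) consume. CLAIM.
[cite: Zhang2022LandauSiegel, §5.u002 p.24] -/
def Sec5_u002b' : Prop :=
  ∃ C : ℝ, ForAllLarge fun D _ _ => ∀ x : Chr D, ∀ s : ℂ, InRange51 D s →
    ∀ v' : ℝ, |v'| < ell D ^ 20 →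
      ‖logDeriv (GammaFactor.Zfac x.ψ) (s + v' * I) + Real.log (x.p * s.im / (2 * π))‖
        ≤ C * (1 + |v'|) * (t0 D)⁻¹

/-- The printed `§5.u002` (second equality) implies its corrected reading (`1 ≤ 1 + |v′|`).
[cite: Zhang2022LandauSiegel, §5.u002 p.24] -/
theorem sec5_u002b'_of (h : Sec5_u002b) : Sec5_u002b' := by
  obtain ⟨C, h⟩ := h
  refine ⟨max C 0, h.mono fun D _ χ _ _ h x s hs v' hv' => (h x s hs v' hv').trans ?_⟩
  have ht : 0 ≤ (t0 D)⁻¹ := inv_nonneg.mpr (pow_nonneg (Real.log_natCast_nonneg D) _)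
  refine mul_le_mul_of_nonneg_right ?_ ht
  calc C ≤ max C 0 := le_max_left C 0
    _ = max C 0 * 1 := (mul_one _).symm
    _ ≤ max C 0 * (1 + |v'|) :=
        mul_le_mul_of_nonneg_left (by linarith [abs_nonneg v']) (le_max_right C 0)

/-- **`Z22:§5.u003`, AS PRINTED** (proof of Lemma 5.1): "Hence `Z(s+w,ψ) = Z(s,ψ)(pt/2π)^{−w} + O(|w|/t₀)`"
(`w = iv`, `|v| < 𝓛²⁰`, `t = Im s`, absolute implied constant). CLAIM — see the module CAVEAT (the true
discrepancy is `≍ |Z(s,ψ)|v²/(2t)`; derivable form `Sec5_u003'`). [cite: Zhang2022LandauSiegel, §5.u003 p.24] -/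
def Sec5_u003 : Prop :=
  ∃ C : ℝ, ForAllLarge fun D _ _ => ∀ x : Chr D, ∀ s : ℂ, InRange51 D s → ∀ v : ℝ, |v| < ell D ^ 20 →
    ‖GammaFactor.Zfac x.ψ (s + v * I) -
        GammaFactor.Zfac x.ψ s * (((x.p : ℝ) * s.im / (2 * π) : ℝ) : ℂ) ^ (-(v * I))‖
      ≤ C * |v| * (t0 D)⁻¹

/-- **`Z22:§5.u003`, CORRECTED READING** (typer's variant): error `O(|w|(1 + |w|)/t₀)` — the form of the
tree's `GammaFactor.norm_Zfac_vertical_shift_sub_le`. CLAIM. [cite: Zhang2022LandauSiegel, §5.u003 p.24] -/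
def Sec5_u003' : Prop :=
  ∃ C : ℝ, ForAllLarge fun D _ _ => ∀ x : Chr D, ∀ s : ℂ, InRange51 D s → ∀ v : ℝ, |v| < ell D ^ 20 →
    ‖GammaFactor.Zfac x.ψ (s + v * I) -
        GammaFactor.Zfac x.ψ s * (((x.p : ℝ) * s.im / (2 * π) : ℝ) : ℂ) ^ (-(v * I))‖
      ≤ C * |v| * (1 + |v|) * (t0 D)⁻¹

/-- The printed `§5.u003` implies its corrected reading. [cite: Zhang2022LandauSiegel, §5.u003 p.24] -/
theorem sec5_u003'_of (h : Sec5_u003) : Sec5_u003' := by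
  obtain ⟨C, h⟩ := h
  refine ⟨max C 0, h.mono fun D _ χ _ _ h x s hs v hv => (h x s hs v hv).trans ?_⟩
  have ht : 0 ≤ (t0 D)⁻¹ := inv_nonneg.mpr (pow_nonneg (Real.log_natCast_nonneg D) _)
  refine mul_le_mul_of_nonneg_right ?_ ht
  have h0 : 0 ≤ max C 0 * |v| := mul_nonneg (le_max_right C 0) (abs_nonneg v)
  calc C * |v| ≤ max C 0 * |v| := mul_le_mul_of_nonneg_right (le_max_left C 0) (abs_nonneg v)
    _ = max C 0 * |v| * 1 := (mul_one _).symm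
    _ ≤ max C 0 * |v| * (1 + |v|) := mul_le_mul_of_nonneg_left (by linarith [abs_nonneg v]) h0

/-- **`Z22:§5.u004`** (proof of Lemma 5.1, last display): "This yields (5.1) and (5.2) since
`pt/2π = pt₀(1 + O(𝓛⁻¹¹⁴))`, `pt/2π = Pt₀(1 + O(𝓛⁻⁶⁸))`" — for `p ∼ P` and `|t − 2πt₀| < 𝓛₁ + 2`
(`𝓛₁/t₀ = 𝓛⁻¹¹⁴`; `p/P = 1 + O(𝓛⁻⁶⁸)` by the window). CLAIM. [cite: Zhang2022LandauSiegel, §5.u004 p.24] -/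
def Sec5_u004 : Prop :=
  ∃ C : ℝ, ForAllLarge fun D _ _ => ∀ x : Chr D, ∀ s : ℂ, InRange51 D s →
    |(x.p : ℝ) * s.im / (2 * π) - x.p * t0 D| ≤ C * (ell D ^ 114)⁻¹ * (x.p * t0 D) ∧
    |(x.p : ℝ) * s.im / (2 * π) - bigP D * t0 D| ≤ C * (ell D ^ 68)⁻¹ * (bigP D * t0 D)

/-- **`Z22:Lem5.1.pf`** (the manuscript's PROOF of Lemma 5.1, p. 24, as a deduction node): the four
displayed steps `§5.u001`–`§5.u004` (as printed) yield Lemma 5.1 ("The proofs of (5.3) and (5.4) are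
similar"). CLAIM (an implication between typed nodes; discharging it = the parameter bookkeeping).
[cite: Zhang2022LandauSiegel, Lem5.1.pf p.24] -/
def Lem5_1_pf : Prop := Sec5_u001 → Sec5_u002a → Sec5_u002b → Sec5_u003 → Sec5_u004 → Skeleton.Lemma51

/-- **`Z22:Lem5.1.pf`, CORRECTED-READING variant** (typer's variant, INTERFACE §4): the same deduction
with the two affected steps in their derivable form (`Sec5_u002b'`, `Sec5_u003'`). This is the
non-vacuous discharge target for the proof of Lemma 5.1; it implies the printed node (`lem5_1_pf_of`).
CLAIM. [cite: Zhang2022LandauSiegel, Lem5.1.pf p.24] -/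
def Lem5_1_pf' : Prop :=
  Sec5_u001 → Sec5_u002a → Sec5_u002b' → Sec5_u003' → Sec5_u004 → Skeleton.Lemma51

/-- The corrected-reading deduction implies the printed one (its hypotheses are weaker:
`sec5_u002b'_of`, `sec5_u003'_of`). [cite: Zhang2022LandauSiegel, Lem5.1.pf p.24] -/
theorem lem5_1_pf_of (h : Lem5_1_pf') : Lem5_1_pf := fun h1 h2a h2b h3 h4 =>
  h h1 h2a (sec5_u002b'_of h2b) (sec5_u003'_of h3) h4

/-! ## Lemma 5.2 and its proof (pp. 24–25): steps `§5.u005`–`§5.u009` -/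

/-- **Lemma 5.2** (DAG `Z22:Lem5.2`): "Let `ψ` and `s` be as in Lemma 5.1. Then
`Y(s+β₁,ψ)Y(s+β₂,ψ)Y(s+β₃,ψ)/Y(s,ψ) = (pt₀)^{β₃}Z(s,ψ)⁻¹(1 + O(𝓛⁻¹²³))`." This IS the banked node
`Skeleton.Lemma52 c'` (p403321), referenced, not restated. [cite: Zhang2022LandauSiegel, Lemma 5.2 p.24] -/
abbrev Lem5_2 (c' : ℝ) : Prop := Skeleton.Lemma52 c'

/-- **`Z22:§5.u005`** = the displayed assertion of Lemma 5.2 (the DAG lists the display separately from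
the lemma's heading); the same banked node. [cite: Zhang2022LandauSiegel, §5.u005 p.24] -/
abbrev Sec5_u005 (c' : ℝ) : Prop := Skeleton.Lemma52 c'

/-- **`Z22:§5.u006`** (proof of Lemma 5.2, first display): "The left side is
`Z(s,ψ)⁻¹ ∏_{1≤j≤3} (Y(s+β_j,ψ)/Y(s,ψ))`" — the identity `Y(s+β₁)Y(s+β₂)Y(s+β₃)/Y(s) = Z(s)⁻¹∏ⱼ Y(s+βⱼ)/Y(s)`
(from `Y(s)² = Z(s)⁻¹`), for `ψ ∈ Ψ` and `s` in the range of Lemma 5.1. CLAIM.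
[cite: Zhang2022LandauSiegel, §5.u006 p.24] -/
def Sec5_u006 (c' : ℝ) : Prop :=
  ForAllLarge fun D _ _ => ∀ x : Chr D, ∀ s : ℂ, InRange51 D s →
    Yroot x.ψ (s + beta1 c' D) * Yroot x.ψ (s + beta2 c' D) * Yroot x.ψ (s + beta3 c' D) /
        Yroot x.ψ s =
      (GammaFactor.Zfac x.ψ s)⁻¹ *
        ((Yroot x.ψ (s + beta1 c' D) / Yroot x.ψ s) * (Yroot x.ψ (s + beta2 c' D) / Yroot x.ψ s) *
          (Yroot x.ψ (s + beta3 c' D) / Yroot x.ψ s))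

/-- **`Z22:§5.u007`, first equality** (proof of Lemma 5.2): "By (2.6) and the Stirling formula, for
`|w| < 5α`, `(Y′/Y)(s+w,ψ) = −½(Z′/Z)(s+w,ψ)`" (logarithmic derivative of `Y² = Z⁻¹`). CLAIM.
[cite: Zhang2022LandauSiegel, §5.u007 p.25] -/
def Sec5_u007a : Prop :=
  ForAllLarge fun D _ _ => ∀ x : Chr D, ∀ s : ℂ, InRange51 D s → ∀ w : ℂ, ‖w‖ < 5 * alpha D →
    logDeriv (Yroot x.ψ) (s + w) = -(1 / 2) * logDeriv (GammaFactor.Zfac x.ψ) (s + w)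

/-- **`Z22:§5.u007`, second equality**: "`−½(Z′/Z)(s+w,ψ) = ½log(pt₀) + O(𝓛⁻¹¹⁴)`" for `|w| < 5α`,
`ψ ∈ Ψ`, `s` in the range of Lemma 5.1. CLAIM. [cite: Zhang2022LandauSiegel, §5.u007 p.25] -/
def Sec5_u007b : Prop :=
  ∃ C : ℝ, ForAllLarge fun D _ _ => ∀ x : Chr D, ∀ s : ℂ, InRange51 D s → ∀ w : ℂ,
    ‖w‖ < 5 * alpha D →
      ‖-(1 / 2) * logDeriv (GammaFactor.Zfac x.ψ) (s + w) - (1 / 2) * Real.log (x.p * t0 D)‖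
        ≤ C * (ell D ^ 114)⁻¹

/-- The three shifts `β₁, β₂, β₃` of (2.13), as a set. [cite: Zhang2022LandauSiegel, §2 (2.13)] -/
def betaSet (c' : ℝ) (D : ℕ) : Set ℂ := {beta1 c' D, beta2 c' D, beta3 c' D}

/-- **`Z22:§5.u008`, first equality** (proof of Lemma 5.2): "Hence, for `1 ≤ j ≤ 3`,
`Y(s+β_j,ψ)/Y(s,ψ) = exp(∫₀^{β_j} (Y′/Y)(s+w,ψ) dw)`" — path = the segment from `0` to `β_j`
(`w = τβ_j`, `dw = β_j dτ`). CLAIM. [cite: Zhang2022LandauSiegel, §5.u008 p.25] -/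
def Sec5_u008a (c' : ℝ) : Prop :=
  ForAllLarge fun D _ _ => ∀ x : Chr D, ∀ s : ℂ, InRange51 D s → ∀ β ∈ betaSet c' D,
    Yroot x.ψ (s + β) / Yroot x.ψ s =
      Complex.exp (∫ τ : ℝ in (0 : ℝ)..1, logDeriv (Yroot x.ψ) (s + τ * β) * β)

/-- **`Z22:§5.u008`, second equality**: "`… = (pt₀)^{β_j/2}(1 + O(𝓛⁻¹²³))`", `1 ≤ j ≤ 3`. CLAIM.
[cite: Zhang2022LandauSiegel, §5.u008 p.25] -/
def Sec5_u008b (c' : ℝ) : Prop :=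
  ∃ C : ℝ, ForAllLarge fun D _ _ => ∀ x : Chr D, ∀ s : ℂ, InRange51 D s → ∀ β ∈ betaSet c' D,
    ‖Yroot x.ψ (s + β) / Yroot x.ψ s - (((x.p : ℝ) * t0 D : ℝ) : ℂ) ^ (β / 2)‖
      ≤ C * (ell D ^ 123)⁻¹ * ‖(((x.p : ℝ) * t0 D : ℝ) : ℂ) ^ (β / 2)‖

/-- **`Z22:§5.u009`** (proof of Lemma 5.2, last display): "The result now follows since
`(β₁ + β₂ + β₃)/2 = β₃`." An identity between the shifts (2.13). CLAIM — and TRUE by `ring`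
(`sec5_u009_holds`). [cite: Zhang2022LandauSiegel, §5.u009 p.25] -/
def Sec5_u009 (c' : ℝ) : Prop := ∀ D : ℕ, (beta1 c' D + beta2 c' D + beta3 c' D) / 2 = beta3 c' D

/-- **`Z22:Lem5.2.pf`** (the manuscript's PROOF of Lemma 5.2, pp. 24–25, as a deduction node): the steps
`§5.u006`–`§5.u009` yield Lemma 5.2. CLAIM. [cite: Zhang2022LandauSiegel, Lem5.2.pf p.24] -/
def Lem5_2_pf (c' : ℝ) : Prop :=
  Sec5_u006 c' → Sec5_u007a → Sec5_u007b → Sec5_u008a c' → Sec5_u008b c' → Sec5_u009 c' →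
    Skeleton.Lemma52 c'

/-! ## `ϑ(1−s)`, (5.5), `ϑ*`, `Δ₁` (5.6), `Δ` (5.7), and `ω(1/2+2πix) > 0` (p. 25) -/

/-- **`Z22:§5.u010`** (p. 25): "Recall that `ϑ(s)` and `ω(s)` are given by (2.3) and (2.15)
respectively. It is known that `ϑ(1−s) = 2(2π)^{−s}Γ(s)cos(πs/2)`." CLAIM — and a THEOREM of the tree
(`GammaFactor.vartheta_one_sub`, Titchmarsh (2.1.10)); `sec5_u010_holds`.
[cite: Zhang2022LandauSiegel, §5.u010 p.25] [cite: Titchmarsh1986, §2.1 (2.1.10)] -/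
def Sec5_u010 : Prop :=
  ∀ s : ℂ, GammaFactor.vartheta (1 - s) =
    2 * (2 * π : ℂ) ^ (-s) * Complex.Gamma s * Complex.cos (π * s / 2)

/-- **(5.5)** (DAG `Z22:(5.5)`, p. 25): "For `t > 1` we have `ϑ(1−s) = ϑ*(1−s)(1 + O(e^{−πt}))`",
`t = Im s`. CLAIM — and a THEOREM of the tree with implied constant `1` (`eq5_5_holds`).
[cite: Zhang2022LandauSiegel, (5.5) p.25] -/
def Eq5_5 : Prop :=
  ∃ C : ℝ, ∀ s : ℂ, 1 < s.im →
    ‖GammaFactor.vartheta (1 - s) - GammaFactor.varthetaStarOneSub s‖ ≤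
      C * Real.exp (-π * s.im) * ‖GammaFactor.varthetaStarOneSub s‖

/-- **`Z22:§5.u011`** (step-def, p. 25): "where `ϑ*(1−s) = (2π)^{−s}Γ(s)e(−s/4)`", `e(z) = e^{2πiz}`. The
object is the tree's `GammaFactor.varthetaStarOneSub` (a function of `s`, written there with
`e(−s/4) = exp(−πis/2)`); this node records the printed formula. CLAIM — TRUE (`sec5_u011_holds`).
[cite: Zhang2022LandauSiegel, §5.u011 p.25] -/
def Sec5_u011 : Prop :=
  ∀ s : ℂ, GammaFactor.varthetaStarOneSub s =
    (2 * π : ℂ) ^ (-s) * Complex.Gamma s * Complex.exp (2 * π * I * (-s / 4))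

/-- **`Δ₁(x)` of (5.6)** at the manuscript's parameters `(𝓛₂, t₀)`: the tree's `Lemma53.Delta1_56`
(so that `Skeleton.DeltaW D x = DeltaOneW D x · e(x)` is (5.7), `eq5_7_holds`).
[cite: Zhang2022LandauSiegel, (5.6) p.25] -/
def DeltaOneW (D : ℕ) (x : ℝ) : ℂ := Lemma53.Delta1_56 (ell2 D) (t0 D) x

/-- **(5.6)** (DAG `Z22:(5.6)`, p. 25): "`Δ₁(x) = (1/2πi)∫_{(3/2)} x^{−s}ϑ*(1−s)ω(s) ds`" — on the line
`s = 3/2 + it`, `ds = i dt`, i.e. `(1/2π)∫_ℝ x^{−(3/2+it)}ϑ*(1−(3/2+it))ω(3/2+it) dt`. CLAIM (a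
definition; `eq5_6_holds` by `rfl`). [cite: Zhang2022LandauSiegel, (5.6) p.25] -/
def Eq5_6 : Prop :=
  ∀ (D : ℕ) (x : ℝ), DeltaOneW D x =
    1 / (2 * π) * ∫ t : ℝ, (x : ℂ) ^ (-((3 / 2 : ℂ) + t * I)) *
      GammaFactor.varthetaStarOneSub ((3 / 2 : ℂ) + t * I) * omegaW D ((3 / 2 : ℂ) + t * I)

/-- **(5.7)** (DAG `Z22:(5.7)`, p. 25): "`Δ(x) = Δ₁(x)e(x)`", `e(x) = e^{2πix}`; `Δ` is the banked object
`Skeleton.DeltaW`. CLAIM (a definition; `eq5_7_holds` by `rfl`). [cite: Zhang2022LandauSiegel, (5.7) p.25] -/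
def Eq5_7 : Prop :=
  ∀ (D : ℕ) (x : ℝ), DeltaW D x = DeltaOneW D x * Complex.exp (2 * π * I * x)

/-- **`Z22:§5.u012`** (the Note before Lemma 5.3, p. 25): "Note that
`ω(1/2+2πix) = (√π/𝓛₂)exp{−(π(x−t₀)/𝓛₂)²} > 0`" — for every real `x` (and every `D ≥ 2`, so that
`𝓛₂ = (log D)⁴⁰⁰ > 0`). CLAIM — TRUE (`sec5_u012_holds`, tree `SmoothWeight.omega_half_eq`, `omegaLine_pos`).
[cite: Zhang2022LandauSiegel, §5.u012 p.25] -/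
def Sec5_u012 : Prop :=
  ∀ D : ℕ, 2 ≤ D → ∀ x : ℝ,
    omegaW D (1 / 2 + 2 * π * x * I) =
        ((Real.sqrt π / ell2 D * Real.exp (-(π * (x - t0 D) / ell2 D) ^ 2) : ℝ) : ℂ) ∧
      0 < Real.sqrt π / ell2 D * Real.exp (-(π * (x - t0 D) / ell2 D) ^ 2)


/-! ## Discharges from the tree (no new facts) -/

/-- `log D ≥ 1` once `D ≥ 3`. [folklore] -/
private theorem one_le_ell {D : ℕ} (hD : 3 ≤ D) : 1 ≤ ell D := by
  have hD' : (3 : ℝ) ≤ D := by exact_mod_cast hD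
  have h3 : (1 : ℝ) ≤ Real.log 3 := by
    rw [Real.le_log_iff_exp_le (by norm_num)]
    exact Real.exp_one_lt_d9.le.trans (by norm_num)
  exact h3.trans (Real.log_le_log (by norm_num) hD')

/-- `log D ≥ 2` once `D ≥ 9` (`e² < 9`). [folklore] -/
private theorem two_le_ell {D : ℕ} (hD : 9 ≤ D) : 2 ≤ ell D := by
  have hD' : (9 : ℝ) ≤ D := by exact_mod_cast hD
  have h9 : (2 : ℝ) ≤ Real.log 9 := by
    rw [Real.le_log_iff_exp_le (by norm_num)]
    have h := Real.exp_one_lt_d9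
    have : Real.exp 2 = Real.exp 1 * Real.exp 1 := by rw [← Real.exp_add]; norm_num
    rw [this]
    nlinarith [Real.exp_pos 1]
  exact h9.trans (Real.log_le_log (by norm_num) hD')

/-- In the range of Lemma 5.1, for `D ≥ 3`, every point `s + w` with `|Im w| ≤ 𝓛⁵¹⁹` has imaginary
part `≥ 𝓛⁵¹⁹` (`Im s > 2πt₀ − 𝓛₁ − 2 ≥ (2π − 3)𝓛⁵¹⁹`). [cite: Zhang2022LandauSiegel, §5 Lemma 5.1 p.24] -/
private theorem im_add_large {D : ℕ} (hD : 3 ≤ D) {s : ℂ} (hs : InRange51 D s) {w : ℂ}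
    (hw : |w.im| ≤ ell D ^ 519) : ell D ^ 519 ≤ (s + w).im := by
  have hL := one_le_ell hD
  have him : |s.im - 2 * π * t0 D| < ell1 D + 2 := hs.2
  rw [ell1, t0] at him
  have hA : ell D ^ 405 ≤ ell D ^ 519 := pow_le_pow_right₀ hL (by norm_num)
  have h1 : (1 : ℝ) ≤ ell D ^ 519 := one_le_pow₀ hL
  have hπ : (3 : ℝ) < π := Real.pi_gt_three
  have h6 : 6 * ell D ^ 519 < 2 * π * ell D ^ 519 := by nlinarith
  have hlow := (abs_lt.mp him).1
  have hw' := (abs_le.mp hw).1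
  rw [Complex.add_im]
  linarith

/-- In the range of Lemma 5.1 (`D ≥ 3`), `Im(s + iy) ≥ 𝓛⁵¹⁹ > 0` for `|y| ≤ 𝓛²⁰`. [folklore] -/
private theorem im_shift_large {D : ℕ} (hD : 3 ≤ D) {s : ℂ} (hs : InRange51 D s) {y : ℝ}
    (hy : |y| ≤ ell D ^ 20) : ell D ^ 519 ≤ (s + y * I).im := by
  refine im_add_large hD hs ?_
  have : ((y : ℂ) * I).im = y := by simp
  rw [this]
  exact hy.trans (pow_le_pow_right₀ (one_le_ell hD) (by norm_num))

/-- In the range of Lemma 5.1 (`D ≥ 3`), `Im(s + iy) > 0` for `|y| ≤ 𝓛²⁰`. [folklore] -/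
private theorem im_shift_pos {D : ℕ} (hD : 3 ≤ D) {s : ℂ} (hs : InRange51 D s) {y : ℝ}
    (hy : |y| ≤ ell D ^ 20) : 0 < (s + y * I).im :=
  lt_of_lt_of_le (lt_of_lt_of_le one_pos (one_le_pow₀ (one_le_ell hD))) (im_shift_large hD hs hy)

/-- In the range of Lemma 5.1 (`D ≥ 3`), `Im s > 0`. [folklore] -/
private theorem im_pos_of_inRange {D : ℕ} (hD : 3 ≤ D) {s : ℂ} (hs : InRange51 D s) : 0 < s.im := by
  have h := im_shift_pos hD hs (y := 0) (by rw [abs_zero]; exact pow_nonneg (Real.log_natCast_nonneg D) 20)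
  simpa using h

/-- **`Z22:§5.u001` DISCHARGED**: the first display of the proof of Lemma 5.1 holds (for every `D ≥ 3`),
by the tree's `eq_mul_exp_I_mul_integral_logDeriv` (`Z(·,ψ)` is analytic and zero-free on the upper
half-plane: `GammaFactor.analyticAt_Zfac`, `GammaFactor.Zfac_ne_zero`), the whole segment `s + i[−|v|,|v|]`
lying in `Im > 0`. [cite: Zhang2022LandauSiegel, §5.u001 p.24] -/
theorem sec5_u001_holds : Sec5_u001 := by
  refine ForAllLarge.of_le 3 fun D _ χ hD _ _ x s hs v hv => ?_
  have hseg : ∀ y ∈ Set.Icc (-|v|) (|v|), 0 < (s + y * I).im := fun y hy =>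
    im_shift_pos hD hs ((abs_le.mpr hy).trans hv.le)
  have hg : ∀ y ∈ Set.Icc (-|v|) (|v|), AnalyticAt ℂ (GammaFactor.Zfac x.ψ) (s + y * I) :=
    fun y hy => GammaFactor.analyticAt_Zfac x.ψ (hseg y hy)
  have h0 : ∀ y ∈ Set.Icc (-|v|) (|v|), GammaFactor.Zfac x.ψ (s + y * I) ≠ 0 :=
    fun y hy => GammaFactor.Zfac_ne_zero x.prim (hseg y hy)
  have hp : (0 : ℝ) ∈ Set.Icc (-|v|) (|v|) := ⟨by simp, by simp⟩
  have hq : v ∈ Set.Icc (-|v|) (|v|) := ⟨neg_abs_le v, le_abs_self v⟩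
  have key := eq_mul_exp_I_mul_integral_logDeriv hg h0 hp hq
  have hs0 : GammaFactor.Zfac x.ψ s ≠ 0 := by simpa using h0 0 hp
  rw [key]
  simp only [ofReal_zero, zero_mul, add_zero]
  rw [mul_div_cancel_left₀ _ hs0]

/-- `e^{πt} − e^{−πt} ≥ e^{πt}/2` for `t ≥ 1`. [folklore] -/
private theorem exp_sub_exp_ge {t : ℝ} (ht : 1 ≤ t) :
    Real.exp (π * t) / 2 ≤ Real.exp (π * t) - Real.exp (-π * t) := by
  have hπ : (3 : ℝ) < π := Real.pi_gt_three
  have h1 : Real.exp (-π * t) ≤ 1 := by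
    rw [Real.exp_le_one_iff]; nlinarith
  have h2 : (2 : ℝ) ≤ Real.exp (π * t) := by
    have h := Real.add_one_le_exp (π * t)
    nlinarith
  linarith

/-- **`Z22:§5.u002` (first equality) DISCHARGED**: "`(Z′/Z)(s+w′,ψ) = −log p + (ϑ′/ϑ)(s+w′) + O(ε)`" holds
with `ε = exp{−𝓛¹⁰}` (`c = 1`) and constant `4π` (all `D ≥ 3`): by the tree's exact identity
`GammaFactor.logDeriv_Zfac_eq` the discrepancy is `E = logDerivCorr ψ (s+w′)`,
`‖E‖ ≤ 2π/(e^{πt′} − e^{−πt′}) ≤ 4πe^{−πt′}` with `t′ = Im(s+w′) ≥ 𝓛⁵¹⁹ ≥ 𝓛¹⁰`.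
[cite: Zhang2022LandauSiegel, §5.u002 p.24] -/
theorem sec5_u002a_holds : Sec5_u002a := by
  refine ⟨1, one_pos, 4 * π, ForAllLarge.of_le 3 fun D _ χ hD _ _ x s hs v' hv' => ?_⟩
  have hL := one_le_ell hD
  have him := im_shift_large hD hs hv'.le
  have h1 : 1 ≤ (s + v' * I).im := (one_le_pow₀ hL).trans him
  have hpos : 0 < (s + v' * I).im := lt_of_lt_of_le one_pos h1
  rw [GammaFactor.logDeriv_Zfac_eq x.prim hpos]
  have e : -(Real.log x.p : ℂ) + logDeriv GammaFactor.vartheta (s + v' * I) +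
        GammaFactor.logDerivCorr x.ψ (s + v' * I) -
      (-(Real.log x.p : ℂ) + logDeriv GammaFactor.vartheta (s + v' * I)) =
      GammaFactor.logDerivCorr x.ψ (s + v' * I) := by ring
  rw [e]
  refine (GammaFactor.norm_logDerivCorr_le x.ψ hpos).trans ?_
  set t := (s + v' * I).im with ht
  have hden : Real.exp (π * t) / 2 ≤ Real.exp (π * t) - Real.exp (-π * t) := exp_sub_exp_ge h1
  have hexp : 0 < Real.exp (π * t) := Real.exp_pos _
  have h10 : ell D ^ 10 ≤ ell D ^ 519 := pow_le_pow_right₀ hL (by norm_num)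
  have hπ : (3 : ℝ) < π := Real.pi_gt_three
  calc 2 * π / (Real.exp (π * t) - Real.exp (-π * t))
      ≤ 2 * π / (Real.exp (π * t) / 2) :=
        div_le_div_of_nonneg_left (by positivity) (by positivity) hden
    _ = 4 * π * Real.exp (-(π * t)) := by rw [Real.exp_neg]; field_simp; ring
    _ ≤ 4 * π * Real.exp (-1 * ell D ^ 10) := by
        gcongr 4 * π * Real.exp ?_
        nlinarith

/-- The window bounds for `p ∼ P`: `P < p < P(1 + 𝓛⁻⁶⁸)` as real numbers.
[cite: Zhang2022LandauSiegel, §2 p.5 (after (2.6))] -/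
private theorem window_bounds {D : ℕ} (x : Chr D) :
    bigP D < x.p ∧ (x.p : ℝ) < bigP D * (1 + (ell D ^ 68)⁻¹) := by
  have hm := x.mem
  rw [primeWindow, Finset.mem_filter, Finset.mem_Ioo] at hm
  obtain ⟨⟨h1, h2⟩, -⟩ := hm
  exact ⟨(Nat.floor_lt (Real.exp_pos _).le).mp h1, Nat.lt_ceil.mp h2⟩

/-- **`Z22:§5.u004` DISCHARGED**: "`pt/2π = pt₀(1 + O(𝓛⁻¹¹⁴))`, `pt/2π = Pt₀(1 + O(𝓛⁻⁶⁸))`" hold with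
constant `3` for all `D ≥ 3`: `|t/2π − t₀| < (𝓛₁+2)/2π ≤ 𝓛⁴⁰⁵ = 𝓛⁻¹¹⁴t₀` and `0 < p − P < P𝓛⁻⁶⁸`.
[cite: Zhang2022LandauSiegel, §5.u004 p.24] -/
theorem sec5_u004_holds : Sec5_u004 := by
  refine ⟨3, ForAllLarge.of_le 3 fun D _ χ hD _ _ x s hs => ?_⟩
  have hL := one_le_ell hD
  have hπ : (3 : ℝ) < π := Real.pi_gt_three
  obtain ⟨hpP, hpP'⟩ := window_bounds x
  have hP : 0 < bigP D := Real.exp_pos _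
  have hp : (0 : ℝ) < x.p := hP.trans hpP
  have him : |s.im - 2 * π * t0 D| < ell1 D + 2 := hs.2
  rw [ell1] at him
  have ht0 : t0 D = ell D ^ 519 := rfl
  have h405 : (1 : ℝ) ≤ ell D ^ 405 := one_le_pow₀ hL
  have ht0pos : 0 < t0 D := by rw [ht0]; positivity
  -- `|t/2π − t₀| ≤ 𝓛⁴⁰⁵` and `𝓛⁴⁰⁵ = 𝓛⁻¹¹⁴ · 𝓛⁵¹⁹`
  have key : |s.im / (2 * π) - t0 D| ≤ ell D ^ 405 := by
    have h2π : (0 : ℝ) < 2 * π := by positivity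
    obtain ⟨hl, hu⟩ := abs_lt.mp him
    rw [abs_le]
    constructor
    · rw [le_sub_iff_add_le, le_div_iff₀ h2π]; nlinarith
    · rw [sub_le_iff_le_add, div_le_iff₀ h2π]; nlinarith
  have hsplit : ell D ^ 405 = (ell D ^ 114)⁻¹ * t0 D := by
    have : ell D ^ 114 ≠ 0 := (pow_pos (lt_of_lt_of_le one_pos hL) _).ne'
    rw [ht0, eq_inv_mul_iff_mul_eq₀ this]; ring
  have key' : |s.im / (2 * π) - t0 D| ≤ (ell D ^ 114)⁻¹ * t0 D := hsplit ▸ key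
  have e114 : 0 ≤ (ell D ^ 114)⁻¹ := inv_nonneg.mpr (by positivity)
  have e68 : 0 ≤ (ell D ^ 68)⁻¹ := inv_nonneg.mpr (by positivity)
  constructor
  · have e : (x.p : ℝ) * s.im / (2 * π) - x.p * t0 D = x.p * (s.im / (2 * π) - t0 D) := by ring
    rw [e, abs_mul, abs_of_pos hp]
    calc (x.p : ℝ) * |s.im / (2 * π) - t0 D| ≤ x.p * ((ell D ^ 114)⁻¹ * t0 D) := by gcongr
      _ = 1 * (ell D ^ 114)⁻¹ * (x.p * t0 D) := by ring
      _ ≤ 3 * (ell D ^ 114)⁻¹ * (x.p * t0 D) :=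
          mul_le_mul_of_nonneg_right (mul_le_mul_of_nonneg_right (by norm_num) e114)
            (mul_pos hp ht0pos).le
  · -- `|pt/2π − Pt₀| ≤ p|t/2π − t₀| + (p − P)t₀ ≤ 2P𝓛⁻¹¹⁴t₀ + P𝓛⁻⁶⁸t₀ ≤ 3P𝓛⁻⁶⁸t₀`
    have hinv1 : (ell D ^ 68)⁻¹ ≤ 1 := inv_le_one_of_one_le₀ (one_le_pow₀ hL)
    have hp2 : (x.p : ℝ) ≤ 2 * bigP D :=
      calc (x.p : ℝ) ≤ bigP D * (1 + (ell D ^ 68)⁻¹) := hpP'.le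
        _ ≤ bigP D * 2 := mul_le_mul_of_nonneg_left (by linarith) hP.le
        _ = 2 * bigP D := mul_comm _ _
    have h114le68 : (ell D ^ 114)⁻¹ ≤ (ell D ^ 68)⁻¹ := by
      apply inv_anti₀ (by positivity)
      exact pow_le_pow_right₀ hL (by norm_num)
    have e : (x.p : ℝ) * s.im / (2 * π) - bigP D * t0 D =
        x.p * (s.im / (2 * π) - t0 D) + (x.p - bigP D) * t0 D := by ring
    rw [e]
    calc |(x.p : ℝ) * (s.im / (2 * π) - t0 D) + (x.p - bigP D) * t0 D|
        ≤ |(x.p : ℝ) * (s.im / (2 * π) - t0 D)| + |((x.p : ℝ) - bigP D) * t0 D| := abs_add_le _ _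
      _ = x.p * |s.im / (2 * π) - t0 D| + (x.p - bigP D) * t0 D := by
          rw [abs_mul, abs_of_pos hp, abs_mul, abs_of_pos (sub_pos.mpr hpP), abs_of_pos ht0pos]
      _ ≤ 2 * bigP D * ((ell D ^ 68)⁻¹ * t0 D) + bigP D * (ell D ^ 68)⁻¹ * t0 D := by
          have hA : |s.im / (2 * π) - t0 D| ≤ (ell D ^ 68)⁻¹ * t0 D :=
            key'.trans (mul_le_mul_of_nonneg_right h114le68 ht0pos.le)
          have hB : (x.p : ℝ) - bigP D ≤ bigP D * (ell D ^ 68)⁻¹ := by nlinarith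
          have h1 : (x.p : ℝ) * |s.im / (2 * π) - t0 D| ≤ 2 * bigP D * ((ell D ^ 68)⁻¹ * t0 D) :=
            mul_le_mul hp2 hA (abs_nonneg _) (by positivity)
          have h2 : ((x.p : ℝ) - bigP D) * t0 D ≤ bigP D * (ell D ^ 68)⁻¹ * t0 D :=
            mul_le_mul_of_nonneg_right hB ht0pos.le
          linarith
      _ = 3 * (ell D ^ 68)⁻¹ * (bigP D * t0 D) := by ring

/-- **`Z22:§5.u006` DISCHARGED**: "The left side is `Z(s,ψ)⁻¹∏ⱼ(Y(s+βⱼ,ψ)/Y(s,ψ))`" — from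
`Y(s,ψ)² = Z(s,ψ)⁻¹` (`Skeleton.Yroot_spec`) and `Y(s,ψ) ≠ 0` (`Z(s,ψ) ≠ 0` on `Im s > 0`,
`GammaFactor.Zfac_ne_zero`), for every `D ≥ 3`. [cite: Zhang2022LandauSiegel, §5.u006 p.24] -/
theorem sec5_u006_holds (c' : ℝ) : Sec5_u006 c' := by
  refine ForAllLarge.of_le 3 fun D _ χ hD _ _ x s hs => ?_
  have him : 0 < s.im := im_pos_of_inRange hD hs
  have hY2 : Yroot x.ψ s ^ 2 = (GammaFactor.Zfac x.ψ s)⁻¹ := (Yroot_spec x.prim).2 s him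
  have hZ : GammaFactor.Zfac x.ψ s ≠ 0 := GammaFactor.Zfac_ne_zero x.prim him
  have hY : Yroot x.ψ s ≠ 0 := by
    intro h
    rw [h, zero_pow two_ne_zero] at hY2
    exact (inv_ne_zero hZ) hY2.symm
  rw [← hY2]
  field_simp

/-- **`Z22:§5.u007` (first equality) DISCHARGED**: "`(Y′/Y)(s+w,ψ) = −½(Z′/Z)(s+w,ψ)`" for `|w| < 5α`
— the logarithmic derivative of `Y² = Z⁻¹` (`Skeleton.Yroot_spec`) at `z = s + w`, a point of the
upper half-plane (`|Im w| ≤ |w| < 5α = 5π𝓛⁻⁹ < 1 ≤ 𝓛⁵¹⁹` once `𝓛 ≥ 2`, i.e. `D ≥ 9`).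
[cite: Zhang2022LandauSiegel, §5.u007 p.25] -/
theorem sec5_u007a_holds : Sec5_u007a := by
  refine ForAllLarge.of_le 9 fun D _ χ hD _ _ x s hs w hw => ?_
  have hD3 : 3 ≤ D := le_trans (by norm_num) hD
  have hL2 := two_le_ell hD
  have hα : alpha D = π / ell D ^ 9 := by rw [alpha, bigP, Real.log_exp]
  have hwim : |w.im| ≤ ell D ^ 519 := by
    have h1 : |w.im| ≤ ‖w‖ := Complex.abs_im_le_norm w
    have h9 : (2 : ℝ) ^ 9 ≤ ell D ^ 9 := pow_le_pow_left₀ (by norm_num) hL2 9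
    have h519 : (1 : ℝ) ≤ ell D ^ 519 := one_le_pow₀ (by linarith)
    have hπ : π < 4 := Real.pi_lt_four
    have h5 : 5 * alpha D ≤ 1 := by
      rw [hα, mul_div_assoc', div_le_one (by positivity)]
      nlinarith
    linarith
  set z := s + w with hz
  have hzim : 0 < z.im :=
    lt_of_lt_of_le (by positivity) (im_add_large hD3 hs hwim)
  have hYd : DifferentiableAt ℂ (Yroot x.ψ) z :=
    (Yroot_spec x.prim).1.differentiableAt
      ((isOpen_lt continuous_const Complex.continuous_im).mem_nhds hzim)
  have hZd : DifferentiableAt ℂ (GammaFactor.Zfac x.ψ) z := GammaFactor.differentiableAt_Zfac x.ψ hzim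
  -- `2·(Y′/Y) = logDeriv (Y²) = logDeriv (Z⁻¹) = −Z′/Z` at `z`
  have hE : (fun u => Yroot x.ψ u ^ 2) =ᶠ[nhds z] fun u => GammaFactor.Zfac x.ψ u ^ (-1 : ℤ) := by
    have ho : IsOpen {u : ℂ | 0 < u.im} := isOpen_lt continuous_const Complex.continuous_im
    filter_upwards [ho.mem_nhds hzim] with u hu
    rw [(Yroot_spec x.prim).2 u hu, zpow_neg_one]
  have h2 : logDeriv (fun u => Yroot x.ψ u ^ 2) z = 2 * logDeriv (Yroot x.ψ) z := by
    exact_mod_cast logDeriv_fun_pow hYd 2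
  have h3 : logDeriv (fun u => GammaFactor.Zfac x.ψ u ^ (-1 : ℤ)) z =
      (-1 : ℤ) * logDeriv (GammaFactor.Zfac x.ψ) z := logDeriv_fun_zpow hZd (-1)
  have h5 : Yroot x.ψ z ^ 2 = GammaFactor.Zfac x.ψ z ^ (-1 : ℤ) := hE.self_of_nhds
  have h4 : logDeriv (fun u => Yroot x.ψ u ^ 2) z =
      logDeriv (fun u => GammaFactor.Zfac x.ψ u ^ (-1 : ℤ)) z := by
    rw [logDeriv_apply, logDeriv_apply, hE.deriv_eq, h5]
  rw [h2, h3] at h4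
  push_cast at h4
  linear_combination (1 / 2 : ℂ) * h4

/-- **`Z22:§5.u009` DISCHARGED**: `(β₁ + β₂ + β₃)/2 = β₃` for the shifts (2.13)
(`iα[(1−5c′α𝓛) + 2(1+c′α𝓛) + 3(1−c′α𝓛)] = 6iα(1−c′α𝓛) = 2β₃`). [cite: Zhang2022LandauSiegel, §5.u009 p.25] -/
theorem sec5_u009_holds (c' : ℝ) : Sec5_u009 c' := by
  intro D
  simp only [beta1, beta2, beta3]
  push_cast
  ring

/-- **`Z22:§5.u010` DISCHARGED** ("It is known that"): the tree's `GammaFactor.vartheta_one_sub`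
(Titchmarsh (2.1.10)). [cite: Zhang2022LandauSiegel, §5.u010 p.25] [cite: Titchmarsh1986, §2.1 (2.1.10)] -/
theorem sec5_u010_holds : Sec5_u010 := fun s => GammaFactor.vartheta_one_sub s

/-- **(5.5) DISCHARGED** with implied constant `1` and for every `s` (not only `t > 1`): the tree's exact
form `ϑ(1−s) = ϑ*(1−s)(1 + q)`, `q = e^{iπs}`, `|q| = e^{−πt}` (`GammaFactor.vartheta_one_sub_eq_star_mul`,
`GammaFactor.norm_qexp`). [cite: Zhang2022LandauSiegel, (5.5) p.25] -/
theorem eq5_5_holds : Eq5_5 := by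
  refine ⟨1, fun s _ => ?_⟩
  rw [GammaFactor.vartheta_one_sub_eq_star_mul, mul_add, mul_one, add_sub_cancel_left, norm_mul,
    GammaFactor.norm_qexp, one_mul, mul_comm]

/-- **`Z22:§5.u011` DISCHARGED**: the printed `ϑ*(1−s) = (2π)^{−s}Γ(s)e(−s/4)` is the tree's
`GammaFactor.varthetaStarOneSub s` (`e(−s/4) = exp(2πi·(−s/4)) = exp(−πis/2)`).
[cite: Zhang2022LandauSiegel, §5.u011 p.25] -/
theorem sec5_u011_holds : Sec5_u011 := by
  intro s
  rw [GammaFactor.varthetaStarOneSub]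
  congr 1
  congr 1
  ring

/-- **(5.6) DISCHARGED** (definitional): `DeltaOneW` is the printed line integral, with `ω = Skeleton.omegaW D`
(`= SmoothWeight.omega 𝓛₂ t₀`). [cite: Zhang2022LandauSiegel, (5.6) p.25] -/
theorem eq5_6_holds : Eq5_6 := fun _ _ => rfl

/-- **(5.7) DISCHARGED** (definitional): `Skeleton.DeltaW D x = Δ₁(x)e(x)` with `Δ₁ = DeltaOneW D`
(tree `Lemma53.Delta57 = Delta1_56 · e(x)`). [cite: Zhang2022LandauSiegel, (5.7) p.25] -/
theorem eq5_7_holds : Eq5_7 := fun _ _ => rfl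

/-- `𝓛₂ = (log D)⁴⁰⁰ > 0` for `D ≥ 2`. [folklore] -/
private theorem ell2_pos {D : ℕ} (hD : 2 ≤ D) : 0 < ell2 D := by
  have hD' : (2 : ℝ) ≤ D := by exact_mod_cast hD
  exact pow_pos (Real.log_pos (by linarith)) 400

/-- **`Z22:§5.u012` DISCHARGED**: `ω(1/2+2πix) = (√π/𝓛₂)exp{−(π(x−t₀)/𝓛₂)²} > 0`, by the tree's
`SmoothWeight.omega_half_eq` and `SmoothWeight.omegaLine_pos`. [cite: Zhang2022LandauSiegel, §5.u012 p.25] -/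
theorem sec5_u012_holds : Sec5_u012 := by
  intro D hD x
  have hL := ell2_pos hD
  exact ⟨SmoothWeight.omega_half_eq hL.ne' (t0 D) x, SmoothWeight.omegaLine_pos hL (t0 D) x⟩

end Literature.NumberTheory.LFunctions.Zhang2022.Typed

namespace Literature.NumberTheory.LFunctions.Zhang2022.Typed

open Literature.NumberTheory.LFunctions.Zhang2022.Skeleton

/-! ## Discharges of the Stirling steps `§5.u007` (second equality) and `§5.u002` (corrected reading) -/

/-- `|log u| ≤ 2|u − 1|` for `u ≥ 1/2` (from `1 − 1/u ≤ log u ≤ u − 1`). [folklore] -/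
private theorem abs_log_le_two_mul {u : ℝ} (hu : 1 / 2 ≤ u) : |Real.log u| ≤ 2 * |u - 1| := by
  have hu0 : 0 < u := by linarith
  have h1 : Real.log u ≤ u - 1 := Real.log_le_sub_one_of_pos hu0
  have h2 : 1 - u⁻¹ ≤ Real.log u := Real.one_sub_inv_le_log_of_pos hu0
  rw [abs_le]
  constructor
  · -- `log u ≥ 1 − 1/u = (u−1)/u ≥ −2|u−1|`
    have h3 : 1 - u⁻¹ = (u - 1) / u := by field_simp
    rw [h3] at h2
    have h4 : -(2 * |u - 1|) ≤ (u - 1) / u := by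
      rw [le_div_iff₀ hu0]
      cases le_or_gt 1 u with
      | inl h => rw [abs_of_nonneg (by linarith)]; nlinarith
      | inr h => rw [abs_of_neg (by linarith)]; nlinarith
    linarith
  · exact h1.trans ((le_abs_self _).trans (by linarith [abs_nonneg (u - 1)]))

/-- `log D ≥ 2` once `D ≥ 9` (`e² < 9`). [folklore] -/
private theorem two_le_ell' {D : ℕ} (hD : 9 ≤ D) : 2 ≤ ell D := by
  have hD' : (9 : ℝ) ≤ D := by exact_mod_cast hD
  have h9 : (2 : ℝ) ≤ Real.log 9 := by
    rw [Real.le_log_iff_exp_le (by norm_num)]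
    have h := Real.exp_one_lt_d9
    have : Real.exp 2 = Real.exp 1 * Real.exp 1 := by rw [← Real.exp_add]; norm_num
    rw [this]
    nlinarith [Real.exp_pos 1]
  exact h9.trans (Real.log_le_log (by norm_num) hD')

/-- `α = π𝓛⁻⁹ ≤ 1/100` once `𝓛 ≥ 2`. [cite: Zhang2022LandauSiegel, §2 (2.10)] -/
private theorem alpha_small {D : ℕ} (hL : 2 ≤ ell D) : 0 < alpha D ∧ alpha D ≤ 1 / 100 := by
  have hα : alpha D = π / ell D ^ 9 := by rw [alpha, bigP, Real.log_exp]
  have h9 : (2 : ℝ) ^ 9 ≤ ell D ^ 9 := pow_le_pow_left₀ (by norm_num) hL 9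
  have hπ : π < 4 := Real.pi_lt_four
  rw [hα]
  refine ⟨div_pos Real.pi_pos (by positivity), ?_⟩
  rw [div_le_div_iff₀ (by positivity) (by norm_num)]
  nlinarith

/-- The core Stirling estimate behind `§5.u002`/`§5.u007`: for `ψ ∈ Ψ`, `D ≥ 9`, and a point `z` with
`0 < Re z ≤ 1` and `Im z ≥ 𝓛⁵¹⁹ (≥ 2)`:
`‖(Z′/Z)(z,ψ) + log p + log(Im z/2π)‖ ≤ 12/Im z`
(`logDeriv_Zfac_eq` + Stirling `norm_logDeriv_vartheta_add_log_le` with `A = 1` + `‖E‖ ≤ 2/Im z`).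
[cite: Zhang2022LandauSiegel, §5.u002 p.24] -/
private theorem norm_logDeriv_Zfac_add_log_le {D : ℕ} (hD : 9 ≤ D) (x : Chr D) {z : ℂ}
    (hre0 : 0 < z.re) (hre1 : z.re ≤ 1) (him : ell D ^ 519 ≤ z.im) :
    ‖logDeriv (GammaFactor.Zfac x.ψ) z + Real.log x.p + Real.log (z.im / (2 * π))‖ ≤ 12 / z.im := by
  have hL := two_le_ell' hD
  have h519 : (2 : ℝ) ≤ ell D ^ 519 :=
    le_trans (le_self_pow₀ (by norm_num : (1 : ℝ) ≤ 2) (by norm_num : (519 : ℕ) ≠ 0))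
      (pow_le_pow_left₀ (by norm_num) hL 519)
  have him2 : 2 ≤ z.im := h519.trans him
  have him0 : 0 < z.im := by linarith
  rw [GammaFactor.logDeriv_Zfac_eq x.prim him0]
  have hst := GammaFactor.norm_logDeriv_vartheta_add_log_le (A := 1) le_rfl hre0 hre1
    (t := z.im) (by linarith)
  rw [Complex.re_add_im] at hst
  have hE : ‖GammaFactor.logDerivCorr x.ψ z‖ ≤ 2 / z.im :=
    (GammaFactor.norm_logDerivCorr_le x.ψ him0).trans (two_pi_div_exp_sub_exp_le (by linarith))
  have e : -(Real.log x.p : ℂ) + logDeriv GammaFactor.vartheta z + GammaFactor.logDerivCorr x.ψ z +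
        Real.log x.p + Real.log (z.im / (2 * π)) =
      (logDeriv GammaFactor.vartheta z + Real.log (z.im / (2 * π))) +
        GammaFactor.logDerivCorr x.ψ z := by ring
  rw [e]
  calc ‖(logDeriv GammaFactor.vartheta z + Real.log (z.im / (2 * π))) +
          GammaFactor.logDerivCorr x.ψ z‖
      ≤ ‖logDeriv GammaFactor.vartheta z + Real.log (z.im / (2 * π))‖ +
          ‖GammaFactor.logDerivCorr x.ψ z‖ := norm_add_le _ _
    _ ≤ (2 * 1 + 3) / z.im + 2 / z.im := add_le_add hst hE
    _ ≤ 12 / z.im := by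
        rw [← add_div, div_le_div_iff_of_pos_right him0]; norm_num

/-- In the range of Lemma 5.1 (`D ≥ 3`): a point `s + w` with `|Im w| ≤ 𝓛⁴⁰⁵ + 3` satisfies
`Im(s+w) ≥ 𝓛⁵¹⁹` and `|Im(s+w)/(2π) − t₀| ≤ 𝓛⁴⁰⁵ + … ≤ 𝓛⁻¹¹⁴·… `; precisely
`|Im(s+w)/(2πt₀) − 1| ≤ (𝓛⁴⁰⁵ + 2 + |Im w|)/(2πt₀)`. [cite: Zhang2022LandauSiegel, §5.u004 p.24] -/
private theorem im_ratio_sub_one_le {D : ℕ} (hD : 3 ≤ D) {s : ℂ} (hs : InRange51 D s) (w : ℂ) :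
    |(s + w).im / (2 * π * t0 D) - 1| ≤ (ell D ^ 405 + 2 + |w.im|) / (2 * π * t0 D) := by
  have hL := one_le_ell hD
  have ht0 : 0 < t0 D := lt_of_lt_of_le one_pos (one_le_pow₀ hL)
  have h2πt : 0 < 2 * π * t0 D := by positivity
  have him : |s.im - 2 * π * t0 D| < ell1 D + 2 := hs.2
  rw [ell1] at him
  have e : (s + w).im / (2 * π * t0 D) - 1 = ((s.im - 2 * π * t0 D) + w.im) / (2 * π * t0 D) := by
    rw [Complex.add_im]; field_simp; ring
  rw [e, abs_div, abs_of_pos h2πt, div_le_div_iff_of_pos_right h2πt]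
  exact (abs_add_le _ _).trans (by linarith)

/-- **`Z22:§5.u007` (second equality) DISCHARGED**: "`−½(Z′/Z)(s+w,ψ) = ½log(pt₀) + O(𝓛⁻¹¹⁴)`" for
`|w| < 5α`, with constant `8` and all `D ≥ 9`: Stirling at `z = s + w` (`Im z ≥ 𝓛⁵¹⁹`) gives
`(Z′/Z)(z) = −log p − log(Im z/2π) + O(12/Im z)`, and `|log(Im z/(2πt₀))| ≤ 2|Im z/(2πt₀) − 1| ≤ 𝓛⁻¹¹⁴`
(`|Im z − 2πt₀| ≤ 𝓛⁴⁰⁵ + 2 + 5α`, `t₀ = 𝓛⁵¹⁹`). [cite: Zhang2022LandauSiegel, §5.u007 p.25] -/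
theorem sec5_u007b_holds : Sec5_u007b := by
  refine ⟨8, ForAllLarge.of_le 9 fun D _ χ hD _ _ x s hs w hw => ?_⟩
  have hD3 : 3 ≤ D := le_trans (by norm_num) hD
  have hL := two_le_ell' hD
  have hL1 : 1 ≤ ell D := by linarith
  obtain ⟨hα0, hα1⟩ := alpha_small hL
  have hπ3 : (3 : ℝ) < π := Real.pi_gt_three
  set z := s + w with hz
  -- the point `z = s + w`: `0 < Re z ≤ 1`, `Im z ≥ 𝓛⁵¹⁹`
  have hwre : |w.re| < 5 * alpha D := lt_of_le_of_lt (Complex.abs_re_le_norm w) hw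
  have hwim : |w.im| < 5 * alpha D := lt_of_le_of_lt (Complex.abs_im_le_norm w) hw
  have hsre : |s.re - 1 / 2| ≤ alpha D := hs.1
  have hre0 : 0 < z.re := by
    rw [hz, Complex.add_re]
    have := (abs_le.mp hsre).1; have := (abs_lt.mp hwre).1; nlinarith
  have hre1 : z.re ≤ 1 := by
    rw [hz, Complex.add_re]
    have := (abs_le.mp hsre).2; have := (abs_lt.mp hwre).2; nlinarith
  have h519 : (1 : ℝ) ≤ ell D ^ 519 := one_le_pow₀ hL1
  have hwim' : |w.im| ≤ ell D ^ 519 := by linarith [hwim.le]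
  have him : ell D ^ 519 ≤ z.im := im_add_large hD3 hs hwim'
  have him0 : 0 < z.im := lt_of_lt_of_le (by linarith) him
  have ht0 : t0 D = ell D ^ 519 := rfl
  have ht0pos : 0 < t0 D := by rw [ht0]; linarith
  have hp : (0 : ℝ) < x.p := by exact_mod_cast x.prime.pos
  -- Stirling
  have hst := norm_logDeriv_Zfac_add_log_le hD x hre0 hre1 him
  -- the ratio `u = Im z/(2πt₀)`, `|u − 1| ≤ 𝓛⁻¹¹⁴/2`
  set u : ℝ := z.im / (2 * π * t0 D) with hu
  have hu1 : |u - 1| ≤ (ell D ^ 114)⁻¹ / 2 := by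
    have h := im_ratio_sub_one_le hD3 hs w
    rw [← hz] at h
    refine h.trans ?_
    rw [div_le_div_iff₀ (by positivity) (by norm_num), ht0]
    have h405 : ell D ^ 405 * ell D ^ 114 = ell D ^ 519 := by ring
    have h114 : (1 : ℝ) ≤ ell D ^ 114 := one_le_pow₀ hL1
    have hne : ell D ^ 114 ≠ 0 := by positivity
    have h5α : 5 * alpha D ≤ 1 := by linarith
    -- `(𝓛⁴⁰⁵ + 2 + |Im w|)·2·𝓛¹¹⁴ ≤ 2π𝓛⁵¹⁹`, i.e. `2𝓛⁵¹⁹ + (4 + 2|Im w|)𝓛¹¹⁴ ≤ 2π𝓛⁵¹⁹`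
    have key : (ell D ^ 405 + 2 + |w.im|) * 2 ≤ (ell D ^ 114)⁻¹ * (2 * π * ell D ^ 519) := by
      rw [← h405]
      field_simp
      have h405' : (3 + |w.im|) * 1 ≤ 1 * ell D ^ 405 := by
        have h4 : (4 : ℝ) ≤ ell D ^ 405 :=
          calc (4 : ℝ) = 2 ^ 2 := by norm_num
            _ ≤ ell D ^ 2 := pow_le_pow_left₀ (by norm_num) hL 2
            _ ≤ ell D ^ 405 := pow_le_pow_right₀ hL1 (by norm_num)
        have h3 : |w.im| ≤ 1 := by linarith [hwim.le]
        nlinarith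
      nlinarith [h114, pow_nonneg (zero_le_one.trans hL1) 405]
    linarith
  have hu_half : 1 / 2 ≤ u := by
    have h114 : (ell D ^ 114)⁻¹ ≤ 1 := inv_le_one_of_one_le₀ (one_le_pow₀ hL1)
    have := (abs_le.mp hu1).1
    linarith
  have hlogu : |Real.log u| ≤ (ell D ^ 114)⁻¹ :=
    (abs_log_le_two_mul hu_half).trans (by linarith)
  -- `log(Im z/2π) = log u + log t₀`, `log(p t₀) = log p + log t₀`
  have hlog1 : Real.log (z.im / (2 * π)) = Real.log u + Real.log (t0 D) := by
    rw [hu, ← Real.log_mul (by positivity) ht0pos.ne']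
    congr 1; field_simp
  have hlog2 : Real.log (x.p * t0 D) = Real.log x.p + Real.log (t0 D) :=
    Real.log_mul hp.ne' ht0pos.ne'
  -- assemble: `−½Z′/Z − ½log(pt₀) = −½(Z′/Z + log p + log(Im z/2π)) + ½ log u`
  have e : -(1 / 2) * logDeriv (GammaFactor.Zfac x.ψ) z - (1 / 2) * (Real.log (x.p * t0 D) : ℂ) =
      -(1 / 2) * (logDeriv (GammaFactor.Zfac x.ψ) z + Real.log x.p + Real.log (z.im / (2 * π))) +
        (1 / 2) * (Real.log u : ℂ) := by
    rw [hlog1, hlog2]; push_cast; ring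
  rw [e]
  have h12 : 12 / z.im ≤ 12 * (ell D ^ 114)⁻¹ := by
    rw [div_eq_mul_inv]
    refine mul_le_mul_of_nonneg_left ?_ (by norm_num)
    exact (inv_anti₀ (by positivity) him).trans
      (inv_anti₀ (by positivity) (pow_le_pow_right₀ hL1 (by norm_num)))
  calc ‖-(1 / 2) * (logDeriv (GammaFactor.Zfac x.ψ) z + Real.log x.p + Real.log (z.im / (2 * π))) +
          (1 / 2) * (Real.log u : ℂ)‖
      ≤ ‖-(1 / 2) * (logDeriv (GammaFactor.Zfac x.ψ) z + Real.log x.p + Real.log (z.im / (2 * π)))‖ +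
          ‖(1 / 2) * (Real.log u : ℂ)‖ := norm_add_le _ _
    _ = 1 / 2 * ‖logDeriv (GammaFactor.Zfac x.ψ) z + Real.log x.p + Real.log (z.im / (2 * π))‖ +
          1 / 2 * |Real.log u| := by
        rw [norm_mul, norm_mul, norm_neg, Complex.norm_real, Real.norm_eq_abs]
        norm_num
    _ ≤ 1 / 2 * (12 * (ell D ^ 114)⁻¹) + 1 / 2 * (ell D ^ 114)⁻¹ := by
        gcongr
        · exact hst.trans h12
    _ ≤ 8 * (ell D ^ 114)⁻¹ := by nlinarith [inv_nonneg.mpr (pow_nonneg (zero_le_one.trans hL1) 114)]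

/-- **`Z22:§5.u002` (second equality, corrected reading) DISCHARGED**: for `ψ ∈ Ψ`, `s` in the range
of Lemma 5.1 (`t = Im s`) and `|v′| < 𝓛²⁰`: `‖(Z′/Z)(s+iv′,ψ) + log(pt/2π)‖ ≤ 12(1+|v′|)/t₀` (all
`D ≥ 9`) — Stirling at `z = s + iv′` plus `|log(Im z/t)| ≤ 2|v′|/t`, `t ≥ t₀`.
[cite: Zhang2022LandauSiegel, §5.u002 p.24] -/
theorem sec5_u002b'_holds : Sec5_u002b' := by
  refine ⟨12, ForAllLarge.of_le 9 fun D _ χ hD _ _ x s hs v' hv' => ?_⟩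
  have hD3 : 3 ≤ D := le_trans (by norm_num) hD
  have hL := two_le_ell' hD
  have hL1 : 1 ≤ ell D := by linarith
  obtain ⟨hα0, hα1⟩ := alpha_small hL
  have hπ3 : (3 : ℝ) < π := Real.pi_gt_three
  set z := s + v' * I with hz
  have hsre : |s.re - 1 / 2| ≤ alpha D := hs.1
  have hzre : z.re = s.re := by simp [hz]
  have hre0 : 0 < z.re := by rw [hzre]; have := (abs_le.mp hsre).1; linarith
  have hre1 : z.re ≤ 1 := by rw [hzre]; have := (abs_le.mp hsre).2; linarith
  have him : ell D ^ 519 ≤ z.im := im_shift_large hD3 hs hv'.le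
  have ht0 : t0 D = ell D ^ 519 := rfl
  have h519 : (1 : ℝ) ≤ ell D ^ 519 := one_le_pow₀ hL1
  have ht0pos : 0 < t0 D := by rw [ht0]; linarith
  have him0 : 0 < z.im := by linarith
  -- `t = Im s ≥ t₀`
  have hst0 : ell D ^ 519 ≤ s.im := by
    have h := im_add_large hD3 hs (w := 0) (by simpa using (zero_le_one.trans h519))
    simpa using h
  have ht : 0 < s.im := by linarith
  have hp : (0 : ℝ) < x.p := by exact_mod_cast x.prime.pos
  -- Stirling at `z`
  have hstir := norm_logDeriv_Zfac_add_log_le hD x hre0 hre1 him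
  -- `u = Im z / t = 1 + v′/t`
  have hzim : z.im = s.im + v' := by simp [hz]
  set u : ℝ := z.im / s.im with hu
  have hu1 : u - 1 = v' / s.im := by
    rw [hu, hzim]; field_simp; ring
  have hv't : |v'| / s.im ≤ 1 / 2 := by
    rw [div_le_iff₀ ht]
    have h20 : ell D ^ 20 * 2 ≤ ell D ^ 519 := by
      calc ell D ^ 20 * 2 ≤ ell D ^ 20 * ell D ^ 1 := by
            rw [pow_one]; exact mul_le_mul_of_nonneg_left hL (by positivity)
        _ = ell D ^ 21 := by ring
        _ ≤ ell D ^ 519 := pow_le_pow_right₀ hL1 (by norm_num)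
    linarith [hv'.le]
  have hu_half : 1 / 2 ≤ u := by
    have : |u - 1| ≤ 1 / 2 := by rw [hu1, abs_div, abs_of_pos ht]; exact hv't
    have := (abs_le.mp this).1; linarith
  have hlogu : |Real.log u| ≤ 2 * (|v'| / s.im) := by
    have := abs_log_le_two_mul hu_half
    rwa [hu1, abs_div, abs_of_pos ht] at this
  -- `log(pt/2π) = log p + log(Im z/2π) − log u`
  have hu0 : 0 < u := by linarith
  have hlog : (Real.log (x.p * s.im / (2 * π)) : ℂ) =
      (Real.log x.p : ℂ) + Real.log (z.im / (2 * π)) - Real.log u := by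
    have e1 : (x.p : ℝ) * s.im / (2 * π) = x.p * (s.im / (2 * π)) := by ring
    have e2 : z.im / (2 * π) = u * (s.im / (2 * π)) := by rw [hu]; field_simp
    rw [e1, Real.log_mul hp.ne' (by positivity), e2, Real.log_mul hu0.ne' (by positivity)]
    push_cast; ring
  have e : logDeriv (GammaFactor.Zfac x.ψ) z + (Real.log (x.p * s.im / (2 * π)) : ℂ) =
      (logDeriv (GammaFactor.Zfac x.ψ) z + Real.log x.p + Real.log (z.im / (2 * π))) -
        (Real.log u : ℂ) := by
    rw [hlog]; ring
  rw [e]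
  have hinv : z.im⁻¹ ≤ (t0 D)⁻¹ := by rw [ht0]; exact inv_anti₀ (by positivity) him
  have hinv' : s.im⁻¹ ≤ (t0 D)⁻¹ := by rw [ht0]; exact inv_anti₀ (by positivity) hst0
  have ht0inv : 0 ≤ (t0 D)⁻¹ := inv_nonneg.mpr ht0pos.le
  calc ‖(logDeriv (GammaFactor.Zfac x.ψ) z + Real.log x.p + Real.log (z.im / (2 * π))) -
          (Real.log u : ℂ)‖
      ≤ ‖logDeriv (GammaFactor.Zfac x.ψ) z + Real.log x.p + Real.log (z.im / (2 * π))‖ +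
          ‖(Real.log u : ℂ)‖ := norm_sub_le _ _
    _ ≤ 12 / z.im + 2 * (|v'| / s.im) := by
        rw [Complex.norm_real, Real.norm_eq_abs]; exact add_le_add hstir hlogu
    _ = 12 * z.im⁻¹ + 2 * |v'| * s.im⁻¹ := by rw [div_eq_mul_inv, div_eq_mul_inv]; ring
    _ ≤ 12 * (t0 D)⁻¹ + 2 * |v'| * (t0 D)⁻¹ := by
        gcongr
    _ ≤ 12 * (1 + |v'|) * (t0 D)⁻¹ := by nlinarith [abs_nonneg v']

/-! ## Discharge of `§5.u008` (first equality): the segment integral of `Y′/Y` -/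

/-- The shifts `β ∈ {β₁, β₂, β₃}` (2.13) are purely imaginary, `β = ib` with
`|b| ≤ 3α + 5|c′|α²𝓛` (for `α, 𝓛 ≥ 0`). [cite: Zhang2022LandauSiegel, §2 (2.13)] -/
private theorem exists_eq_mul_I_of_mem_betaSet {c' : ℝ} {D : ℕ} (hα : 0 ≤ alpha D) (hL : 0 ≤ ell D)
    {β : ℂ} (hβ : β ∈ betaSet c' D) :
    ∃ b : ℝ, β = b * I ∧ |b| ≤ 3 * alpha D + 5 * |c'| * alpha D ^ 2 * ell D := by
  have hx : |c' * alpha D * ell D| = |c'| * alpha D * ell D := by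
    rw [abs_mul, abs_mul, abs_of_nonneg hα, abs_of_nonneg hL]
  simp only [betaSet, Set.mem_insert_iff, Set.mem_singleton_iff] at hβ
  rcases hβ with h | h | h
  · refine ⟨alpha D * (1 - 5 * c' * alpha D * ell D), ?_, ?_⟩
    · rw [h, beta1]; push_cast; ring
    · rw [abs_mul, abs_of_nonneg hα]
      have h1 : |1 - 5 * c' * alpha D * ell D| ≤ 1 + 5 * (|c'| * alpha D * ell D) := by
        rw [← hx]
        calc |1 - 5 * c' * alpha D * ell D| = |1 + -(5 * (c' * alpha D * ell D))| := by ring_nf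
          _ ≤ |(1 : ℝ)| + |-(5 * (c' * alpha D * ell D))| := abs_add_le _ _
          _ = 1 + 5 * |c' * alpha D * ell D| := by
              rw [abs_one, abs_neg, abs_mul, abs_of_pos (by norm_num : (0:ℝ) < 5)]
      nlinarith [mul_nonneg hα (abs_nonneg c'), mul_nonneg (mul_nonneg hα (abs_nonneg c')) hα,
        mul_nonneg (mul_nonneg (mul_nonneg hα (abs_nonneg c')) hα) hL]
  · refine ⟨2 * alpha D * (1 + c' * alpha D * ell D), ?_, ?_⟩
    · rw [h, beta2]; push_cast; ring
    · rw [abs_mul, abs_mul, abs_of_pos (by norm_num : (0:ℝ) < 2), abs_of_nonneg hα]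
      have h1 : |1 + c' * alpha D * ell D| ≤ 1 + |c'| * alpha D * ell D := by
        rw [← hx]
        exact (abs_add_le _ _).trans (by rw [abs_one])
      nlinarith [mul_nonneg hα (abs_nonneg c'), mul_nonneg (mul_nonneg hα (abs_nonneg c')) hα,
        mul_nonneg (mul_nonneg (mul_nonneg hα (abs_nonneg c')) hα) hL]
  · refine ⟨3 * alpha D * (1 - c' * alpha D * ell D), ?_, ?_⟩
    · rw [h, beta3]; push_cast; ring
    · rw [abs_mul, abs_mul, abs_of_pos (by norm_num : (0:ℝ) < 3), abs_of_nonneg hα]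
      have h1 : |1 - c' * alpha D * ell D| ≤ 1 + |c'| * alpha D * ell D := by
        rw [← hx]
        exact (abs_sub _ _).trans (by rw [abs_one])
      nlinarith [mul_nonneg hα (abs_nonneg c'), mul_nonneg (mul_nonneg hα (abs_nonneg c')) hα,
        mul_nonneg (mul_nonneg (mul_nonneg hα (abs_nonneg c')) hα) hL]

/-- A threshold `D₀(c′)` beyond which `𝓛 = log D ≥ 20|c′| + 2` (so `𝓛 ≥ 2` and `5π|c′| ≤ 𝓛⁸`): the
"sufficiently large `D`" of the skeleton's `ForAllLarge`, depending on the unspecified constant `c′`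
of (2.13). [cite: Zhang2022LandauSiegel, §2 p.5] -/
private theorem ell_large_of_le {c' : ℝ} {D : ℕ} (hD : ⌈Real.exp (20 * |c'| + 2)⌉₊ ≤ D) :
    20 * |c'| + 2 ≤ ell D := by
  have h1 : Real.exp (20 * |c'| + 2) ≤ D := (Nat.le_ceil _).trans (by exact_mod_cast hD)
  have hDpos : (0 : ℝ) < D := lt_of_lt_of_le (Real.exp_pos _) h1
  rw [ell, Real.le_log_iff_exp_le hDpos]
  exact h1

/-- Under `𝓛 ≥ 20|c′| + 2`: `|c′|α𝓛 ≤ 1/10` and every `β ∈ {β₁,β₂,β₃}` has `β = ib`, `|b| ≤ 4α < 5α`,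
`|b| ≤ 1`. [cite: Zhang2022LandauSiegel, §2 (2.13)] -/
private theorem betaSet_bound {c' : ℝ} {D : ℕ} (hL : 20 * |c'| + 2 ≤ ell D) {β : ℂ}
    (hβ : β ∈ betaSet c' D) :
    ∃ b : ℝ, β = b * I ∧ |b| ≤ 4 * alpha D ∧ |b| < 5 * alpha D ∧ |b| ≤ 1 := by
  have hL2 : 2 ≤ ell D := by linarith [abs_nonneg c']
  have hL0 : 0 ≤ ell D := by linarith
  obtain ⟨hα0, hα1⟩ := alpha_small hL2
  obtain ⟨b, hb, hble⟩ := exists_eq_mul_I_of_mem_betaSet hα0.le hL0 hβ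
  have hα : alpha D = π / ell D ^ 9 := by rw [alpha, bigP, Real.log_exp]
  -- `|c′|α𝓛 = π|c′|/𝓛⁸ ≤ π|c′|/𝓛 ≤ 1/5`
  have hcαL : |c'| * alpha D * ell D ≤ 1 / 5 := by
    rw [hα]
    have hL8 : ell D * ell D ^ 7 = ell D ^ 8 := by ring
    have h7 : (1 : ℝ) ≤ ell D ^ 7 := one_le_pow₀ (by linarith)
    have hπ : π < 4 := Real.pi_lt_four
    have hpos : 0 < ell D ^ 9 := by positivity
    rw [show |c'| * (π / ell D ^ 9) * ell D = |c'| * π * ell D / ell D ^ 9 by ring,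
      div_le_iff₀ hpos]
    have : |c'| * π * ell D ≤ 4 * |c'| * ell D := by
      nlinarith [mul_nonneg (mul_nonneg (abs_nonneg c') hL0) (sub_nonneg.mpr hπ.le)]
    have h2 : 4 * |c'| * ell D * 5 ≤ ell D * ell D := by
      nlinarith [mul_nonneg (sub_nonneg.mpr hL) hL0, abs_nonneg c']
    calc |c'| * π * ell D ≤ 4 * |c'| * ell D := this
      _ ≤ 1 / 5 * (ell D * ell D) := by linarith
      _ ≤ 1 / 5 * (ell D * ell D) * ell D ^ 7 := le_mul_of_one_le_right (by positivity) h7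
      _ = 1 / 5 * ell D ^ 9 := by ring
  have hb4 : |b| ≤ 4 * alpha D := by
    have : 5 * |c'| * alpha D ^ 2 * ell D = 5 * alpha D * (|c'| * alpha D * ell D) := by ring
    rw [this] at hble
    nlinarith
  exact ⟨b, hb, hb4, by linarith, by linarith⟩

/-- **`Z22:§5.u008` (first equality) DISCHARGED**: "`Y(s+β_j,ψ)/Y(s,ψ) = exp(∫₀^{β_j}(Y′/Y)(s+w,ψ)dw)`"
for `j = 1,2,3` — `Y(·,ψ)` is analytic and zero-free on the upper half-plane (`Skeleton.Yroot_spec`,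
`Y² = Z⁻¹ ≠ 0`), `β_j = ib_j` is purely imaginary with `|b_j| ≤ 1`, so the vertical segment
`s + i[−|b_j|, |b_j|]` stays in `Im > 0` and the tree's `eq_mul_exp_I_mul_integral_logDeriv` applies;
the substitution `w = τβ_j` turns `i∫₀^{b_j}` into `∫₀¹ … β_j dτ`. Holds for `D ≥ D₀(c′)` with
`log D₀ = 20|c′| + 2`. [cite: Zhang2022LandauSiegel, §5.u008 p.25] -/
theorem sec5_u008a_holds (c' : ℝ) : Sec5_u008a c' := by
  refine ForAllLarge.of_le ⌈Real.exp (20 * |c'| + 2)⌉₊ fun D _ χ hD _ _ x s hs β hβ => ?_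
  have hLc := ell_large_of_le hD
  have hL2 : 2 ≤ ell D := by linarith [abs_nonneg c']
  have hL1 : 1 ≤ ell D := by linarith
  have hD3 : 3 ≤ D := by
    by_contra h
    have hD2 : (D : ℝ) ≤ 2 := by exact_mod_cast (by omega : D ≤ 2)
    have : ell D ≤ 1 := by
      rw [ell]
      rcases Nat.eq_zero_or_pos D with h0 | h0
      · simp [h0]
      · calc Real.log D ≤ Real.log 2 := Real.log_le_log (by exact_mod_cast h0) hD2
          _ ≤ 1 := Real.log_two_lt_d9.le.trans (by norm_num)
    linarith
  obtain ⟨b, rfl, -, -, hb1⟩ := betaSet_bound hLc hβ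
  have h519 : (1 : ℝ) ≤ ell D ^ 519 := one_le_pow₀ hL1
  -- the segment `s + iy`, `|y| ≤ |b|`, lies in `Im > 0`
  have hseg : ∀ y ∈ Set.Icc (-|b|) (|b|), 0 < (s + y * I).im := by
    intro y hy
    have hy' : |y| ≤ ell D ^ 519 := (abs_le.mpr hy).trans (hb1.trans h519)
    have h := im_add_large hD3 hs (w := y * I) (by simpa using hy')
    exact lt_of_lt_of_le (lt_of_lt_of_le one_pos h519) h
  have ho : IsOpen {z : ℂ | 0 < z.im} := isOpen_lt continuous_const Complex.continuous_im
  have hY := Yroot_spec x.prim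
  have hg : ∀ y ∈ Set.Icc (-|b|) (|b|), AnalyticAt ℂ (Yroot x.ψ) (s + y * I) :=
    fun y hy => hY.1.analyticAt (ho.mem_nhds (hseg y hy))
  have h0 : ∀ y ∈ Set.Icc (-|b|) (|b|), Yroot x.ψ (s + y * I) ≠ 0 := by
    intro y hy h
    have h2 := hY.2 (s + y * I) (hseg y hy)
    rw [h, zero_pow two_ne_zero] at h2
    exact inv_ne_zero (GammaFactor.Zfac_ne_zero x.prim (hseg y hy)) h2.symm
  have hp : (0 : ℝ) ∈ Set.Icc (-|b|) (|b|) := ⟨by simp, by simp⟩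
  have hq : b ∈ Set.Icc (-|b|) (|b|) := ⟨neg_abs_le b, le_abs_self b⟩
  have key := eq_mul_exp_I_mul_integral_logDeriv hg h0 hp hq
  have hs0 : Yroot x.ψ s ≠ 0 := by simpa using h0 0 hp
  simp only [ofReal_zero, zero_mul, add_zero] at key
  rw [key, mul_div_cancel_left₀ _ hs0]
  congr 1
  -- `i∫₀^b (Y′/Y)(s+iy)dy = ∫₀¹ (Y′/Y)(s+τβ)β dτ`, `β = ib`
  have hsub : ∀ τ : ℝ, s + (τ : ℂ) * ((b : ℂ) * I) = s + ((τ * b : ℝ) : ℂ) * I := by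
    intro τ; push_cast; ring
  simp_rw [hsub]
  rw [intervalIntegral.integral_mul_const]
  have h1 := intervalIntegral.smul_integral_comp_mul_right
    (fun y : ℝ => logDeriv (Yroot x.ψ) (s + (y : ℂ) * I)) b (a := 0) (b := 1)
  simp only [zero_mul, one_mul] at h1
  simp only [logDeriv_apply] at h1 ⊢
  rw [← h1, Complex.real_smul]
  ring

/-! ## Discharge of `§5.u008` (second equality): integrating the Stirling estimate -/

/-- A threshold beyond which `log D ≥ K`. [folklore] -/
private theorem le_ell_of_ceil_exp_le {K : ℝ} {D : ℕ} (hD : ⌈Real.exp K⌉₊ ≤ D) : K ≤ ell D := by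
  have h1 : Real.exp K ≤ D := (Nat.le_ceil _).trans (by exact_mod_cast hD)
  have hDpos : (0 : ℝ) < D := lt_of_lt_of_le (Real.exp_pos _) h1
  rw [ell, Real.le_log_iff_exp_le hDpos]
  exact h1

/-- `D ≥ 3` once `log D ≥ 2`. [folklore] -/
private theorem three_le_of_two_le_ell {D : ℕ} (hL : 2 ≤ ell D) : 3 ≤ D := by
  by_contra h
  have hD2 : (D : ℝ) ≤ 2 := by exact_mod_cast (by omega : D ≤ 2)
  have : ell D ≤ 1 := by
    rw [ell]
    rcases Nat.eq_zero_or_pos D with h0 | h0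
    · simp [h0]
    · calc Real.log D ≤ Real.log 2 := Real.log_le_log (by exact_mod_cast h0) hD2
        _ ≤ 1 := Real.log_two_lt_d9.le.trans (by norm_num)
  linarith

/-- `Y′/Y` is continuous along the segment `τ ↦ s + τβ`, `τ ∈ [0,1]`, when the segment lies in the
upper half-plane (`Y` analytic and zero-free there). [cite: Zhang2022LandauSiegel, §2 p.5] -/
private theorem continuousOn_logDeriv_Yroot_segment {k : ℕ} [NeZero k] {θ : DirichletCharacter ℂ k}
    (hθ : θ.IsPrimitive) {s β : ℂ} (hseg : ∀ τ ∈ Set.Icc (0 : ℝ) 1, 0 < (s + (τ : ℂ) * β).im) :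
    ContinuousOn (fun τ : ℝ => logDeriv (Yroot θ) (s + (τ : ℂ) * β) * β) (Set.Icc 0 1) := by
  have ho : IsOpen {z : ℂ | 0 < z.im} := isOpen_lt continuous_const Complex.continuous_im
  have hY := Yroot_spec hθ
  have han : AnalyticOnNhd ℂ (Yroot θ) {z : ℂ | 0 < z.im} := hY.1.analyticOnNhd ho
  have hne : ∀ z ∈ {z : ℂ | 0 < z.im}, Yroot θ z ≠ 0 := by
    intro z hz h
    have h2 := hY.2 z hz
    rw [h, zero_pow two_ne_zero] at h2
    exact inv_ne_zero (GammaFactor.Zfac_ne_zero hθ hz) h2.symm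
  have hlog : ContinuousOn (logDeriv (Yroot θ)) {z : ℂ | 0 < z.im} := by
    have h1 : ContinuousOn (deriv (Yroot θ)) {z : ℂ | 0 < z.im} := han.deriv.continuousOn
    have h2 : ContinuousOn (Yroot θ) {z : ℂ | 0 < z.im} := hY.1.continuousOn
    exact h1.div h2 hne
  have hg : Continuous fun τ : ℝ => s + (τ : ℂ) * β := by fun_prop
  have hmaps : Set.MapsTo (fun τ : ℝ => s + (τ : ℂ) * β) (Set.Icc 0 1) {z : ℂ | 0 < z.im} :=
    fun τ hτ => hseg τ hτ
  exact (hlog.comp hg.continuousOn hmaps).mul continuousOn_const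

/-- **`Z22:§5.u008` (second equality) DISCHARGED**: "`Y(s+β_j,ψ)/Y(s,ψ) = (pt₀)^{β_j/2}(1 + O(𝓛⁻¹²³))`",
`j = 1,2,3` — integrate `(Y′/Y)(s+w,ψ) = ½log(pt₀) + O(𝓛⁻¹¹⁴)` (`§5.u007`, kernel: `sec5_u007a_holds`,
`sec5_u007b_holds`) along `w = τβ_j` (`§5.u008` first equality, `sec5_u008a_holds`): the exponent is
`(β_j/2)log(pt₀) + E`, `‖E‖ ≤ C|β_j|𝓛⁻¹¹⁴ ≤ 4πC𝓛⁻¹²³` (`|β_j| ≤ 4α`), and `|e^E − 1| ≤ 2‖E‖`.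
Holds for `D ≥ D₀(c′)`. [cite: Zhang2022LandauSiegel, §5.u008 p.25] -/
theorem sec5_u008b_holds (c' : ℝ) : Sec5_u008b c' := by
  obtain ⟨D₁, h8a⟩ := sec5_u008a_holds c'
  obtain ⟨D₂, h7a⟩ := sec5_u007a_holds
  obtain ⟨C₇, D₃, h7b⟩ := sec5_u007b_holds
  set C : ℝ := max C₇ 0 with hC
  refine ⟨8 * π * C, max (max D₁ (max D₂ D₃)) ⌈Real.exp (20 * |c'| + 16 * C + 2)⌉₊,
    fun D _ χ hD hq hp x s hs β hβ => ?_⟩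
  have hD₁ : D₁ ≤ D := le_trans (le_trans (le_max_left _ _) (le_max_left _ _)) hD
  have hD₂ : D₂ ≤ D :=
    le_trans (le_trans (le_trans (le_max_left _ _) (le_max_right _ _)) (le_max_left _ _)) hD
  have hD₃ : D₃ ≤ D :=
    le_trans (le_trans (le_trans (le_max_right _ _) (le_max_right _ _)) (le_max_left _ _)) hD
  have hLK := le_ell_of_ceil_exp_le (le_trans (le_max_right _ _) hD)
  have hC0 : 0 ≤ C := le_max_right _ _
  have hC7 : C₇ ≤ C := le_max_left _ _
  have hLc : 20 * |c'| + 2 ≤ ell D := by linarith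
  have hL2 : 2 ≤ ell D := by linarith [abs_nonneg c']
  have hL1 : 1 ≤ ell D := by linarith
  have hD3 : 3 ≤ D := three_le_of_two_le_ell hL2
  obtain ⟨hα0, hα1⟩ := alpha_small hL2
  obtain ⟨b, hbβ, hb4, hb5, hb1⟩ := betaSet_bound hLc hβ
  have h519 : (1 : ℝ) ≤ ell D ^ 519 := one_le_pow₀ hL1
  have ht0pos : 0 < t0 D := lt_of_lt_of_le one_pos h519
  have hp0 : (0 : ℝ) < x.p := by exact_mod_cast x.prime.pos
  have hpt : (0 : ℝ) < x.p * t0 D := mul_pos hp0 ht0pos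
  -- the three pointwise inputs
  have e8a := h8a D χ hD₁ hq hp x s hs β hβ
  -- the segment lies in `Im > 0` and inside `|w| < 5α`
  have hnormβ : ‖β‖ = |b| := by rw [hbβ, norm_mul, Complex.norm_real, Complex.norm_I, mul_one, Real.norm_eq_abs]
  have hwτ : ∀ τ ∈ Set.Icc (0 : ℝ) 1, ‖(τ : ℂ) * β‖ < 5 * alpha D := by
    intro τ hτ
    rw [norm_mul, Complex.norm_real, Real.norm_eq_abs, abs_of_nonneg hτ.1, hnormβ]
    calc τ * |b| ≤ 1 * |b| := mul_le_mul_of_nonneg_right hτ.2 (abs_nonneg b)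
      _ < 5 * alpha D := by rw [one_mul]; exact hb5
  have hseg : ∀ τ ∈ Set.Icc (0 : ℝ) 1, 0 < (s + (τ : ℂ) * β).im := by
    intro τ hτ
    have him : |((τ : ℂ) * β).im| ≤ ell D ^ 519 := by
      refine le_trans (Complex.abs_im_le_norm _) ((hwτ τ hτ).le.trans ?_)
      linarith
    exact lt_of_lt_of_le (lt_of_lt_of_le one_pos h519) (im_add_large hD3 hs him)
  -- pointwise: `‖(Y′/Y)(s+τβ)β − ½log(pt₀)β‖ ≤ C𝓛⁻¹¹⁴|b|`
  set A : ℂ := (1 / 2 : ℂ) * (Real.log (x.p * t0 D) : ℂ) * β with hA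
  have hpt' : ∀ τ ∈ Set.Icc (0 : ℝ) 1,
      ‖logDeriv (Yroot x.ψ) (s + (τ : ℂ) * β) * β - A‖ ≤ C * (ell D ^ 114)⁻¹ * |b| := by
    intro τ hτ
    have e7a := h7a D χ hD₂ hq hp x s hs ((τ : ℂ) * β) (hwτ τ hτ)
    have e7b := h7b D χ hD₃ hq hp x s hs ((τ : ℂ) * β) (hwτ τ hτ)
    have e : logDeriv (Yroot x.ψ) (s + (τ : ℂ) * β) * β - A =
        (-(1 / 2) * logDeriv (GammaFactor.Zfac x.ψ) (s + (τ : ℂ) * β) -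
          (1 / 2) * (Real.log (x.p * t0 D) : ℂ)) * β := by
      rw [e7a, hA]; ring
    rw [e, norm_mul, hnormβ]
    have h114 : 0 ≤ (ell D ^ 114)⁻¹ := inv_nonneg.mpr (by positivity)
    exact mul_le_mul_of_nonneg_right (e7b.trans (mul_le_mul_of_nonneg_right hC7 h114))
      (abs_nonneg b)
  -- integrate over `[0,1]`
  have hint : IntervalIntegrable (fun τ : ℝ => logDeriv (Yroot x.ψ) (s + (τ : ℂ) * β) * β)
      MeasureTheory.volume 0 1 :=
    (continuousOn_logDeriv_Yroot_segment x.prim hseg).intervalIntegrable_of_Icc zero_le_one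
  set E : ℂ := (∫ τ : ℝ in (0 : ℝ)..1, logDeriv (Yroot x.ψ) (s + (τ : ℂ) * β) * β) - A with hE
  have hEint : E = ∫ τ : ℝ in (0 : ℝ)..1, (logDeriv (Yroot x.ψ) (s + (τ : ℂ) * β) * β - A) := by
    rw [hE, intervalIntegral.integral_sub hint intervalIntegrable_const, intervalIntegral.integral_const]
    simp
  have hEle : ‖E‖ ≤ C * (ell D ^ 114)⁻¹ * |b| := by
    rw [hEint]
    have h := intervalIntegral.norm_integral_le_of_norm_le_const (a := (0 : ℝ)) (b := 1)
      (f := fun τ : ℝ => logDeriv (Yroot x.ψ) (s + (τ : ℂ) * β) * β - A)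
      (C := C * (ell D ^ 114)⁻¹ * |b|) (fun τ hτ => hpt' τ ?_)
    · simpa using h
    · rw [Set.uIoc_of_le zero_le_one] at hτ
      exact ⟨hτ.1.le, hτ.2⟩
  -- `‖E‖ ≤ 4πC𝓛⁻¹²³ ≤ 1`
  have hα : alpha D = π / ell D ^ 9 := by rw [alpha, bigP, Real.log_exp]
  have hE123 : ‖E‖ ≤ 4 * π * C * (ell D ^ 123)⁻¹ := by
    refine hEle.trans ?_
    have h114 : 0 ≤ (ell D ^ 114)⁻¹ := inv_nonneg.mpr (by positivity)
    calc C * (ell D ^ 114)⁻¹ * |b| ≤ C * (ell D ^ 114)⁻¹ * (4 * alpha D) :=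
          mul_le_mul_of_nonneg_left hb4 (mul_nonneg hC0 h114)
      _ = 4 * π * C * (ell D ^ 123)⁻¹ := by
          rw [hα, show ell D ^ 123 = ell D ^ 114 * ell D ^ 9 by ring, mul_inv, div_eq_mul_inv]
          ring
  have hE1 : ‖E‖ ≤ 1 := by
    refine hE123.trans ?_
    have h123 : ell D ≤ ell D ^ 123 := by
      calc ell D = ell D ^ 1 := (pow_one _).symm
        _ ≤ ell D ^ 123 := pow_le_pow_right₀ hL1 (by norm_num)
    have hπ : π < 4 := Real.pi_lt_four
    rw [← div_eq_mul_inv, div_le_one (by positivity)]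
    nlinarith [mul_nonneg (sub_nonneg.mpr hπ.le) hC0, abs_nonneg c']
  -- `Y(s+β)/Y(s) = (pt₀)^{β/2}·e^{E}`
  have hbase : (((x.p : ℝ) * t0 D : ℝ) : ℂ) ^ (β / 2) = Complex.exp A := by
    rw [Complex.cpow_def_of_ne_zero (by exact_mod_cast hpt.ne'), ← Complex.ofReal_log hpt.le, hA]
    congr 1
    ring
  have hquot : Yroot x.ψ (s + β) / Yroot x.ψ s = Complex.exp A * Complex.exp E := by
    rw [e8a, ← Complex.exp_add]
    congr 1
    rw [hE]; ring
  rw [hquot, hbase, ← mul_sub_one, norm_mul]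
  have hexp := Complex.norm_exp_sub_one_le hE1
  calc ‖Complex.exp A‖ * ‖Complex.exp E - 1‖ ≤ ‖Complex.exp A‖ * (2 * ‖E‖) :=
        mul_le_mul_of_nonneg_left hexp (norm_nonneg _)
    _ ≤ ‖Complex.exp A‖ * (2 * (4 * π * C * (ell D ^ 123)⁻¹)) :=
        mul_le_mul_of_nonneg_left (by linarith) (norm_nonneg _)
    _ = 8 * π * C * (ell D ^ 123)⁻¹ * ‖Complex.exp A‖ := by ring

/-! ## Discharge of the proof node `Z22:Lem5.2.pf` -/

/-- Triple products of `(1 + O(η))`-perturbations: if `‖r_j − P_j‖ ≤ η‖P_j‖` (`j = 1,2,3`, `0 ≤ η ≤ 1`)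
then `‖r₁r₂r₃ − P₁P₂P₃‖ ≤ 7η‖P₁P₂P₃‖`. [folklore] -/
private theorem norm_mul3_sub_le {r₁ r₂ r₃ P₁ P₂ P₃ : ℂ} {η : ℝ} (hη0 : 0 ≤ η) (hη1 : η ≤ 1)
    (h₁ : ‖r₁ - P₁‖ ≤ η * ‖P₁‖) (h₂ : ‖r₂ - P₂‖ ≤ η * ‖P₂‖) (h₃ : ‖r₃ - P₃‖ ≤ η * ‖P₃‖) :
    ‖r₁ * r₂ * r₃ - P₁ * P₂ * P₃‖ ≤ 7 * η * ‖P₁ * P₂ * P₃‖ := by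
  set δ₁ := r₁ - P₁
  set δ₂ := r₂ - P₂
  set δ₃ := r₃ - P₃
  have e : r₁ * r₂ * r₃ - P₁ * P₂ * P₃ =
      δ₁ * P₂ * P₃ + P₁ * δ₂ * P₃ + P₁ * P₂ * δ₃ + δ₁ * δ₂ * P₃ + δ₁ * P₂ * δ₃ + P₁ * δ₂ * δ₃ +
        δ₁ * δ₂ * δ₃ := by
    simp only [δ₁, δ₂, δ₃]; ring
  rw [e]
  have n1 := norm_nonneg P₁
  have n2 := norm_nonneg P₂
  have n3 := norm_nonneg P₃
  have hη2 : η * η ≤ η := by nlinarith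
  have hη3 : η * η * η ≤ η := by nlinarith
  have b1 : ‖δ₁ * P₂ * P₃‖ ≤ η * (‖P₁‖ * ‖P₂‖ * ‖P₃‖) := by
    rw [norm_mul, norm_mul]
    calc ‖δ₁‖ * ‖P₂‖ * ‖P₃‖ ≤ η * ‖P₁‖ * ‖P₂‖ * ‖P₃‖ := by gcongr
      _ = _ := by ring
  have b2 : ‖P₁ * δ₂ * P₃‖ ≤ η * (‖P₁‖ * ‖P₂‖ * ‖P₃‖) := by
    rw [norm_mul, norm_mul]
    calc ‖P₁‖ * ‖δ₂‖ * ‖P₃‖ ≤ ‖P₁‖ * (η * ‖P₂‖) * ‖P₃‖ := by gcongr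
      _ = _ := by ring
  have b3 : ‖P₁ * P₂ * δ₃‖ ≤ η * (‖P₁‖ * ‖P₂‖ * ‖P₃‖) := by
    rw [norm_mul, norm_mul]
    calc ‖P₁‖ * ‖P₂‖ * ‖δ₃‖ ≤ ‖P₁‖ * ‖P₂‖ * (η * ‖P₃‖) := by gcongr
      _ = _ := by ring
  have b4 : ‖δ₁ * δ₂ * P₃‖ ≤ η * (‖P₁‖ * ‖P₂‖ * ‖P₃‖) := by
    rw [norm_mul, norm_mul]
    calc ‖δ₁‖ * ‖δ₂‖ * ‖P₃‖ ≤ η * ‖P₁‖ * (η * ‖P₂‖) * ‖P₃‖ := by gcongr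
      _ = η * η * (‖P₁‖ * ‖P₂‖ * ‖P₃‖) := by ring
      _ ≤ η * (‖P₁‖ * ‖P₂‖ * ‖P₃‖) := by gcongr
  have b5 : ‖δ₁ * P₂ * δ₃‖ ≤ η * (‖P₁‖ * ‖P₂‖ * ‖P₃‖) := by
    rw [norm_mul, norm_mul]
    calc ‖δ₁‖ * ‖P₂‖ * ‖δ₃‖ ≤ η * ‖P₁‖ * ‖P₂‖ * (η * ‖P₃‖) := by gcongr
      _ = η * η * (‖P₁‖ * ‖P₂‖ * ‖P₃‖) := by ring
      _ ≤ η * (‖P₁‖ * ‖P₂‖ * ‖P₃‖) := by gcongr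
  have b6 : ‖P₁ * δ₂ * δ₃‖ ≤ η * (‖P₁‖ * ‖P₂‖ * ‖P₃‖) := by
    rw [norm_mul, norm_mul]
    calc ‖P₁‖ * ‖δ₂‖ * ‖δ₃‖ ≤ ‖P₁‖ * (η * ‖P₂‖) * (η * ‖P₃‖) := by gcongr
      _ = η * η * (‖P₁‖ * ‖P₂‖ * ‖P₃‖) := by ring
      _ ≤ η * (‖P₁‖ * ‖P₂‖ * ‖P₃‖) := by gcongr
  have b7 : ‖δ₁ * δ₂ * δ₃‖ ≤ η * (‖P₁‖ * ‖P₂‖ * ‖P₃‖) := by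
    rw [norm_mul, norm_mul]
    calc ‖δ₁‖ * ‖δ₂‖ * ‖δ₃‖ ≤ η * ‖P₁‖ * (η * ‖P₂‖) * (η * ‖P₃‖) := by gcongr
      _ = η * η * η * (‖P₁‖ * ‖P₂‖ * ‖P₃‖) := by ring
      _ ≤ η * (‖P₁‖ * ‖P₂‖ * ‖P₃‖) := by gcongr
  rw [norm_mul, norm_mul]
  refine (norm_add_le _ _).trans ?_
  refine (add_le_add ((norm_add_le _ _).trans (add_le_add ((norm_add_le _ _).trans (add_le_add
    ((norm_add_le _ _).trans (add_le_add ((norm_add_le _ _).trans (add_le_add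
    ((norm_add_le _ _).trans (add_le_add b1 b2)) b3)) b4)) b5)) b6)) b7).trans ?_
  linarith

/-- **`Z22:Lem5.2.pf` DISCHARGED** (the manuscript's proof of Lemma 5.2 from its displayed steps): given
`§5.u006` (the left side is `Z⁻¹∏ⱼY(s+βⱼ)/Y(s)`), `§5.u008` (each factor is `(pt₀)^{βⱼ/2}(1+O(𝓛⁻¹²³))`)
and `§5.u009` (`(β₁+β₂+β₃)/2 = β₃`), Lemma 5.2 follows: the product of the three factors is
`(pt₀)^{β₃}(1 + O(𝓛⁻¹²³))` (`norm_mul3_sub_le`, `cpow_add`). (`§5.u007` and the first equality of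
`§5.u008` enter only through `§5.u008`'s second equality and are not used again.)
[cite: Zhang2022LandauSiegel, Lem5.2.pf p.24] -/
theorem lem5_2_pf_holds (c' : ℝ) : Lem5_2_pf c' := by
  intro h6 _ _ _ h8b h9
  obtain ⟨D₆, h6⟩ := h6
  obtain ⟨C₈, D₈, h8⟩ := h8b
  set C : ℝ := max C₈ 0 with hC
  refine ⟨7 * C, max (max D₆ D₈) ⌈Real.exp (C + 2)⌉₊, fun D _ χ hD hq hp x s hs => ?_⟩
  have hD₆ : D₆ ≤ D := le_trans (le_trans (le_max_left _ _) (le_max_left _ _)) hD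
  have hD₈ : D₈ ≤ D := le_trans (le_trans (le_max_right _ _) (le_max_left _ _)) hD
  have hLK := le_ell_of_ceil_exp_le (le_trans (le_max_right _ _) hD)
  have hC0 : 0 ≤ C := le_max_right _ _
  have hC8 : C₈ ≤ C := le_max_left _ _
  have hL1 : 1 ≤ ell D := by linarith
  have h519 : (1 : ℝ) ≤ ell D ^ 519 := one_le_pow₀ hL1
  have ht0pos : 0 < t0 D := lt_of_lt_of_le one_pos h519
  have hp0 : (0 : ℝ) < x.p := by exact_mod_cast x.prime.pos
  have hpt : (((x.p : ℝ) * t0 D : ℝ) : ℂ) ≠ 0 := by exact_mod_cast (mul_pos hp0 ht0pos).ne'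
  -- `η = C𝓛⁻¹²³ ≤ 1`
  set η : ℝ := C * (ell D ^ 123)⁻¹ with hη
  have h123inv : 0 ≤ (ell D ^ 123)⁻¹ := inv_nonneg.mpr (by positivity)
  have hη0 : 0 ≤ η := mul_nonneg hC0 h123inv
  have hη1 : η ≤ 1 := by
    have h123 : ell D ≤ ell D ^ 123 := by
      calc ell D = ell D ^ 1 := (pow_one _).symm
        _ ≤ ell D ^ 123 := pow_le_pow_right₀ hL1 (by norm_num)
    rw [hη, ← div_eq_mul_inv, div_le_one (by positivity)]
    linarith
  -- the three factors
  set P : ℂ → ℂ := fun β => (((x.p : ℝ) * t0 D : ℝ) : ℂ) ^ (β / 2) with hP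
  have hfac : ∀ β ∈ betaSet c' D, ‖Yroot x.ψ (s + β) / Yroot x.ψ s - P β‖ ≤ η * ‖P β‖ := by
    intro β hβ
    refine (h8 D χ hD₈ hq hp x s hs β hβ).trans ?_
    exact mul_le_mul_of_nonneg_right (mul_le_mul_of_nonneg_right hC8 h123inv) (norm_nonneg _)
  have hβ1 : beta1 c' D ∈ betaSet c' D := by simp [betaSet]
  have hβ2 : beta2 c' D ∈ betaSet c' D := by simp [betaSet]
  have hβ3 : beta3 c' D ∈ betaSet c' D := by simp [betaSet]
  have hprod := norm_mul3_sub_le hη0 hη1 (hfac _ hβ1) (hfac _ hβ2) (hfac _ hβ3)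
  -- `P(β₁)P(β₂)P(β₃) = (pt₀)^{β₃}`
  have hPprod : P (beta1 c' D) * P (beta2 c' D) * P (beta3 c' D) =
      (((x.p : ℝ) * t0 D : ℝ) : ℂ) ^ beta3 c' D := by
    simp only [hP]
    rw [← Complex.cpow_add _ _ hpt, ← Complex.cpow_add _ _ hpt]
    congr 1
    have := h9 D
    linear_combination this
  rw [hPprod] at hprod
  -- assemble with `§5.u006`
  rw [h6 D χ hD₆ hq hp x s hs]
  set Zi : ℂ := (GammaFactor.Zfac x.ψ s)⁻¹
  set R : ℂ := Yroot x.ψ (s + beta1 c' D) / Yroot x.ψ s * (Yroot x.ψ (s + beta2 c' D) / Yroot x.ψ s) *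
    (Yroot x.ψ (s + beta3 c' D) / Yroot x.ψ s)
  set Q : ℂ := (((x.p : ℝ) * t0 D : ℝ) : ℂ) ^ beta3 c' D
  have e : Zi * R - Q * Zi = Zi * (R - Q) := by ring
  rw [e, norm_mul, norm_mul]
  calc ‖Zi‖ * ‖R - Q‖ ≤ ‖Zi‖ * (7 * η * ‖Q‖) := mul_le_mul_of_nonneg_left hprod (norm_nonneg _)
    _ = 7 * C * (ell D ^ 123)⁻¹ * (‖Q‖ * ‖Zi‖) := by rw [hη]; ring

/-! ## The proof node `Z22:Lem5.1.pf` and the corrected `§5.u003`, after the tree's proof of Lemma 5.1 -/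

/-- **`Z22:Lem5.1.pf` (corrected-reading variant) DISCHARGED**: the deduction holds because its
conclusion `Skeleton.Lemma51` is now a THEOREM of the tree (`Skeleton.lemma51_holds`, file
`Section5Lemma51`, which follows the printed route: third display of the proof + the replacements
`pt/2π = pt₀(1+O(𝓛⁻¹¹⁴)) = Pt₀(1+O(𝓛⁻⁶⁸))`). [cite: Zhang2022LandauSiegel, Lem5.1.pf p.24] -/
theorem lem5_1_pf'_holds : Lem5_1_pf' := fun _ _ _ _ _ => Skeleton.lemma51_holds

/-- **`Z22:Lem5.1.pf` (as printed) DISCHARGED** (from the corrected-reading variant, `lem5_1_pf_of`).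
[cite: Zhang2022LandauSiegel, Lem5.1.pf p.24] -/
theorem lem5_1_pf_holds : Lem5_1_pf := lem5_1_pf_of lem5_1_pf'_holds

/-- **`Z22:Lem5.1` holds**: re-export of the tree theorem under the typed name (`Lem5_1 := Skeleton.Lemma51`).
[cite: Zhang2022LandauSiegel, Lemma 5.1 p.24] -/
theorem lem5_1_holds : Lem5_1 := Skeleton.lemma51_holds

/-- **(5.1)–(5.4) hold** (from `Skeleton.lemma51_holds` through the bridge `lemma51_iff`).
[cite: Zhang2022LandauSiegel, (5.1) p.24] -/
theorem eq5_1_holds : Eq5_1 := (lemma51_iff.mp Skeleton.lemma51_holds).1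

/-- **(5.2) holds.** [cite: Zhang2022LandauSiegel, (5.2) p.24] -/
theorem eq5_2_holds : Eq5_2 := (lemma51_iff.mp Skeleton.lemma51_holds).2.1

/-- **(5.3) holds.** [cite: Zhang2022LandauSiegel, (5.3) p.24] -/
theorem eq5_3_holds : Eq5_3 := (lemma51_iff.mp Skeleton.lemma51_holds).2.2.1

/-- **(5.4) holds.** [cite: Zhang2022LandauSiegel, (5.4) p.24] -/
theorem eq5_4_holds : Eq5_4 := (lemma51_iff.mp Skeleton.lemma51_holds).2.2.2

/-- `|log(pt/2π)| ≤ 4𝓛⁹` for `p ∼ P` and `t = Im s` in the range of Lemma 5.1 (`D ≥ 9`):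
`1 ≤ pt/2π`, `log p ≤ 𝓛⁹ + 1`, `log(t/2π) ≤ 1 + 519 log 𝓛 ≤ 1 + 519𝓛`.
[cite: Zhang2022LandauSiegel, §5 Lemma 5.1 (proof) p.24] -/
private theorem abs_log_pt_le {D : ℕ} (hD : 9 ≤ D) (x : Chr D) {s : ℂ} (hs : InRange51 D s) :
    |Real.log ((x.p : ℝ) * s.im / (2 * π))| ≤ 4 * ell D ^ 9 := by
  have hD3 : 3 ≤ D := le_trans (by norm_num) hD
  have hL := two_le_ell' hD
  have hL1 : 1 ≤ ell D := by linarith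
  have hL0 : 0 < ell D := by linarith
  have hπ3 : (3 : ℝ) < π := Real.pi_gt_three
  obtain ⟨hpP, hpP'⟩ := window_bounds x
  have hP1 : 1 ≤ bigP D := by
    rw [bigP]; exact Real.one_le_exp_iff.mpr (by positivity)
  have hp1 : (1 : ℝ) ≤ x.p := by exact_mod_cast x.prime.one_lt.le
  have h519 : (1 : ℝ) ≤ ell D ^ 519 := one_le_pow₀ hL1
  -- `t ≥ 𝓛⁵¹⁹ ≥ 2π`… precisely `t/(2π) ≥ 1` and `t/(2π) ≤ 2t₀`
  have hst0 : ell D ^ 519 ≤ s.im := by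
    have h := im_add_large hD3 hs (w := 0) (by simpa using (zero_le_one.trans h519))
    simpa using h
  have him : |s.im - 2 * π * t0 D| < ell1 D + 2 := hs.2
  rw [ell1, t0] at him
  have h2_519 : (8 : ℝ) ≤ ell D ^ 519 := by
    calc (8 : ℝ) = 2 ^ 3 := by norm_num
      _ ≤ ell D ^ 3 := pow_le_pow_left₀ (by norm_num) hL 3
      _ ≤ ell D ^ 519 := pow_le_pow_right₀ hL1 (by norm_num)
  have ht1 : 1 ≤ s.im / (2 * π) := by
    rw [le_div_iff₀ (by positivity)]
    have hπ4 : π < 4 := Real.pi_lt_four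
    nlinarith
  have ht2 : s.im / (2 * π) ≤ 2 * ell D ^ 519 := by
    rw [div_le_iff₀ (by positivity)]
    have hA : ell D ^ 405 ≤ ell D ^ 519 := pow_le_pow_right₀ hL1 (by norm_num)
    have := (abs_lt.mp him).2
    nlinarith
  -- lower bound: `pt/2π ≥ 1`
  have hq1 : 1 ≤ (x.p : ℝ) * s.im / (2 * π) := by
    rw [mul_div_assoc]
    nlinarith
  rw [abs_of_nonneg (Real.log_nonneg hq1), mul_div_assoc,
    Real.log_mul (by positivity) (by positivity)]
  -- `log p ≤ 𝓛⁹ + 1`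
  have hlogp : Real.log x.p ≤ ell D ^ 9 + 1 := by
    have h2P : (x.p : ℝ) ≤ bigP D * Real.exp 1 := by
      have he : (2 : ℝ) ≤ Real.exp 1 := by
        have := Real.add_one_le_exp (1 : ℝ); linarith
      have hinv : (ell D ^ 68)⁻¹ ≤ 1 := inv_le_one_of_one_le₀ (one_le_pow₀ hL1)
      have hP0 : 0 < bigP D := Real.exp_pos _
      nlinarith
    calc Real.log x.p ≤ Real.log (bigP D * Real.exp 1) :=
          Real.log_le_log (by positivity) h2P
      _ = ell D ^ 9 + 1 := by
          rw [bigP, Real.log_mul (Real.exp_pos _).ne' (Real.exp_pos _).ne', Real.log_exp, Real.log_exp]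
  -- `log(t/2π) ≤ log(2𝓛⁵¹⁹) = log 2 + 519 log 𝓛 ≤ 1 + 519𝓛`
  have hlogt : Real.log (s.im / (2 * π)) ≤ 1 + 519 * ell D := by
    calc Real.log (s.im / (2 * π)) ≤ Real.log (2 * ell D ^ 519) :=
          Real.log_le_log (by positivity) ht2
      _ = Real.log 2 + 519 * Real.log (ell D) := by
          rw [Real.log_mul (by norm_num) (by positivity), Real.log_pow]; norm_num
      _ ≤ 1 + 519 * ell D := by
          have h1 : Real.log 2 ≤ 1 := Real.log_two_lt_d9.le.trans (by norm_num)
          have h2 : Real.log (ell D) ≤ ell D := (Real.log_le_sub_one_of_pos hL0).trans (by linarith)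
          linarith
  -- `2 + 519𝓛 ≤ 3𝓛⁹` for `𝓛 ≥ 2`
  have h9 : 2 + 519 * ell D ≤ 3 * ell D ^ 9 := by
    have h8 : (256 : ℝ) ≤ ell D ^ 8 := by
      calc (256 : ℝ) = 2 ^ 8 := by norm_num
        _ ≤ ell D ^ 8 := pow_le_pow_left₀ (by norm_num) hL 8
    have : ell D ^ 9 = ell D ^ 8 * ell D := by ring
    nlinarith
  linarith

/-- **`Z22:§5.u003` (corrected reading) DISCHARGED**: "`Z(s+w,ψ) = Z(s,ψ)(pt/2π)^{−w} + O(|w|(1+|w|)/t₀)`"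
for `w = iv`, `|v| < 𝓛²⁰` — the tree's `GammaFactor.norm_Zfac_vertical_shift_sub_le` (the third
display made exact) together with the uniform bound `|Z(s,ψ)| ≤ e^{|σ−½|(|log(pt/2π)| + 14/t)} ≤ e¹⁴`
(`GammaFactor.norm_Zfac_le_exp_of_abs_sub_half_le`, file `Section5Lemma51`) on `|σ − ½| ≤ α = π𝓛⁻⁹`,
`|log(pt/2π)| ≤ 4𝓛⁹`. Constant `28e¹⁴`, all `D ≥ 9`; this is the disposition of GAP row G-L1t8-1 for
`§5.u003`. [cite: Zhang2022LandauSiegel, §5.u003 p.24] -/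
theorem sec5_u003'_holds : Sec5_u003' := by
  refine ⟨28 * Real.exp 14, ForAllLarge.of_le 9 fun D _ χ hD _ _ x s hs v hv => ?_⟩
  have hD3 : 3 ≤ D := le_trans (by norm_num) hD
  have hL := two_le_ell' hD
  have hL1 : 1 ≤ ell D := by linarith
  obtain ⟨hα0, hα1⟩ := alpha_small hL
  have hα : alpha D = π / ell D ^ 9 := by rw [alpha, bigP, Real.log_exp]
  have hπ3 : (3 : ℝ) < π := Real.pi_gt_three
  have hπ4 : π < 4 := Real.pi_lt_four
  have h519 : (1 : ℝ) ≤ ell D ^ 519 := one_le_pow₀ hL1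
  have ht0 : t0 D = ell D ^ 519 := rfl
  have ht0pos : 0 < t0 D := by rw [ht0]; linarith
  -- `s = σ + it`, `0 < σ ≤ 1`, `t ≥ 𝓛⁵¹⁹ ≥ 2·𝓛²⁰ + …`
  set σ : ℝ := s.re with hσ
  set t : ℝ := s.im with ht
  have hsdecomp : s = (σ : ℂ) + t * I := (Complex.re_add_im s).symm
  have hsre : |σ - 1 / 2| ≤ alpha D := hs.1
  have hσ0 : 0 < σ := by have := (abs_le.mp hsre).1; linarith
  have hσ1 : σ ≤ 1 := by have := (abs_le.mp hsre).2; linarith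
  have hσq : |σ - 1 / 2| ≤ 1 / 4 := hsre.trans (by linarith)
  have hst0 : ell D ^ 519 ≤ t := by
    have h := im_add_large hD3 hs (w := 0) (by simpa using (zero_le_one.trans h519))
    simpa using h
  have h20 : ell D ^ 20 ≤ ell D ^ 519 / 64 := by
    rw [le_div_iff₀ (by norm_num)]
    calc ell D ^ 20 * 64 = ell D ^ 20 * 2 ^ 6 := by norm_num
      _ ≤ ell D ^ 20 * ell D ^ 6 :=
          mul_le_mul_of_nonneg_left (pow_le_pow_left₀ (by norm_num) hL 6) (by positivity)
      _ = ell D ^ 26 := by ring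
      _ ≤ ell D ^ 519 := pow_le_pow_right₀ hL1 (by norm_num)
  have ht4 : 4 ≤ t := by
    have : (4 : ℝ) ≤ ell D ^ 519 :=
      calc (4 : ℝ) = 2 ^ 2 := by norm_num
        _ ≤ ell D ^ 2 := pow_le_pow_left₀ (by norm_num) hL 2
        _ ≤ ell D ^ 519 := pow_le_pow_right₀ hL1 (by norm_num)
    linarith
  have htpos : 0 < t := by linarith
  have hvt : |v| ≤ t / 2 := by linarith [hv.le]
  have hsmall : (2 * |v| + 4 * 1 + 10) * |v| / t ≤ 1 := by
    rw [div_le_one htpos]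
    have hv0 := abs_nonneg v
    have hv20 := hv.le
    have h1 : (1 : ℝ) ≤ ell D ^ 20 := one_le_pow₀ hL1
    -- `(2|v| + 14)|v| ≤ 16·𝓛²⁰·𝓛²⁰ ≤ 𝓛⁵¹⁹ ≤ t`
    have h2 : (2 * |v| + 4 * 1 + 10) * |v| ≤ 16 * ell D ^ 20 * ell D ^ 20 := by nlinarith
    have h3 : 16 * ell D ^ 20 * ell D ^ 20 ≤ ell D ^ 519 := by
      calc 16 * ell D ^ 20 * ell D ^ 20 = 2 ^ 4 * ell D ^ 40 := by ring
        _ ≤ ell D ^ 4 * ell D ^ 40 :=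
            mul_le_mul_of_nonneg_right (pow_le_pow_left₀ (by norm_num) hL 4) (by positivity)
        _ = ell D ^ 44 := by ring
        _ ≤ ell D ^ 519 := pow_le_pow_right₀ hL1 (by norm_num)
    linarith
  -- the tree's third display, additive form
  have hmain := GammaFactor.norm_Zfac_vertical_shift_sub_le x.prim (A := 1) le_rfl hσ0 hσ1
    (by linarith) hvt hsmall
  -- `|Z(s,ψ)| ≤ e¹⁴`
  have hlog := abs_log_pt_le hD x hs
  have hZ : ‖GammaFactor.Zfac x.ψ ((σ : ℂ) + t * I)‖ ≤ Real.exp 14 := by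
    refine (GammaFactor.norm_Zfac_le_exp_of_abs_sub_half_le x.prim hσq ht4).trans ?_
    refine Real.exp_le_exp.mpr ?_
    have h14t : 14 / t ≤ 4 := by rw [div_le_iff₀ htpos]; linarith
    have h9 : 0 < ell D ^ 9 := by positivity
    calc |σ - 1 / 2| * (|Real.log ((x.p : ℝ) * t / (2 * π))| + 14 / t)
        ≤ alpha D * (4 * ell D ^ 9 + 4) := mul_le_mul hsre (add_le_add hlog h14t)
            (by positivity) hα0.le
      _ = π / ell D ^ 9 * (4 * ell D ^ 9) + 4 * alpha D := by rw [hα]; ring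
      _ = 4 * π + 4 * alpha D := by field_simp
      _ ≤ 14 := by linarith [Real.pi_lt_d2]
  -- `(pt/2π)^{−iv} = exp(−iv·log(pt/2π))`
  have hqpos : 0 < (x.p : ℝ) * t / (2 * π) := by
    have hp : (0 : ℝ) < x.p := by exact_mod_cast x.prime.pos
    positivity
  have hcpow : ((((x.p : ℝ) * t / (2 * π) : ℝ)) : ℂ) ^ (-(v * I)) =
      Complex.exp (-((v : ℂ) * ((Real.log ((x.p : ℝ) * t / (2 * π)) : ℝ) : ℂ)) * I) := by
    rw [Complex.cpow_def_of_ne_zero (by exact_mod_cast hqpos.ne'), ← Complex.ofReal_log hqpos.le]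
    congr 1; ring
  rw [hsdecomp, hcpow]
  refine hmain.trans ?_
  -- `2·e¹⁴·(2|v|+14)|v|/t ≤ 28e¹⁴·|v|(1+|v|)/t₀`
  have hv0 := abs_nonneg v
  have htinv : t⁻¹ ≤ (t0 D)⁻¹ := by rw [ht0]; exact inv_anti₀ (by positivity) hst0
  calc 2 * ‖GammaFactor.Zfac x.ψ ((σ : ℂ) + t * I)‖ * ((2 * |v| + 4 * 1 + 10) * |v| / t)
      ≤ 2 * Real.exp 14 * ((2 * |v| + 4 * 1 + 10) * |v| / t) := by
        gcongr
    _ = 2 * Real.exp 14 * ((2 * |v| + 14) * |v|) * t⁻¹ := by rw [div_eq_mul_inv]; ring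
    _ ≤ 2 * Real.exp 14 * (14 * (1 + |v|) * |v|) * (t0 D)⁻¹ := by
        apply mul_le_mul _ htinv (inv_nonneg.mpr htpos.le) (by positivity)
        gcongr
        nlinarith
    _ = 28 * Real.exp 14 * |v| * (1 + |v|) * (t0 D)⁻¹ := by ring

/-! ## Node `Z22:Lem5.2` re-exported under its node name

The skeleton leaf `Skeleton.Lemma52 c′` (= `Lem5_2 c′` = `Sec5_u005 c′` here) is discharged in
`Section5Lemma52Holds` (`Skeleton.lemma52_holds`, absolute constant `C = 240`, every real `c′`). -/

/-- **Lemma 5.2 holds** (node `Z22:Lem5.2`), for every `c′`: the tree theorem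
`Skeleton.lemma52_holds` under the node name. [cite: Zhang2022LandauSiegel, §5 Lemma 5.2 p.24] -/
theorem lem5_2_holds (c' : ℝ) : Lem5_2 c' := Skeleton.lemma52_holds c'

/-- `§5.u005` (= the statement of Lemma 5.2) holds, for every `c′`.
[cite: Zhang2022LandauSiegel, §5 Lemma 5.2 p.24] -/
theorem sec5_u005_holds (c' : ℝ) : Sec5_u005 c' := Skeleton.lemma52_holds c'

/-! ## Kernel certificate for GAP row G-L1t8-1: the AS-PRINTED `§5.u002` (second equality) is false

The printed display (with `t = Im s` and an absolute implied constant, uniformly in `|w′| < 𝓛²⁰`) is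
refuted by the witness `s = s₀ = 1/2 + 2πit₀`, `v′ = 𝓛²⁰/2`: by the Stirling step the left side equals
`−log(1 + v′/(2πt₀)) + O(12/t₀)`, of size `≍ 𝓛⁻⁴⁹⁹`, against the claimed `O(𝓛⁻⁵¹⁹)`. The standing
quantifier `ForAllLarge` is met by prime moduli `D` with the Legendre character `(·/D) ⊗ ℂ`, and `Ψ`
is non-empty for large `D` (`Skeleton.frakP_eventually_pos`: the window `p ∼ P` contains a prime; a
primitive character mod that prime is again a Legendre character). This certifies the class
«printed-false-pointwise» of the row; the corrected reading `Sec5_u002b'` is PROVED above and is what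
(5.1)–(5.2) consume — nothing here bears on Lemma 5.1, Theorems 1–2 or Landau–Siegel zeros. -/

/-- The Legendre character `(·/p) ⊗ ℂ` mod an odd prime `p` is primitive (non-trivial of prime level).
[folklore] -/
private theorem isPrimitive_legendre {p : ℕ} [Fact p.Prime] (hp2 : p ≠ 2) :
    DirichletCharacter.IsPrimitive ((quadraticChar (ZMod p)).ringHomComp (Int.castRingHom ℂ)) := by
  rw [DirichletCharacter.isPrimitive_def]
  have hdvd := DirichletCharacter.conductor_dvd_level
    ((quadraticChar (ZMod p)).ringHomComp (Int.castRingHom ℂ))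
  rcases (Nat.dvd_prime Fact.out).mp hdvd with h1 | h
  · exfalso
    have hone := DirichletCharacter.eq_one_iff_conductor_eq_one.mpr h1
    have hF : ringChar (ZMod p) ≠ 2 := by rwa [ZMod.ringChar_zmod_n]
    obtain ⟨a, ha⟩ := quadraticChar_exists_neg_one hF
    have hau : IsUnit a := by
      by_contra hau
      rw [MulChar.map_nonunit _ hau] at ha
      norm_num at ha
    have h2 := congrArg (fun χ : DirichletCharacter ℂ p ↦ χ a) hone
    simp only [MulChar.ringHomComp_apply, ha] at h2
    rw [← hau.unit_spec, MulChar.one_apply_coe] at h2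
    norm_num at h2
  · exact h

/-- The Legendre character `(·/p) ⊗ ℂ` is quadratic. [folklore] -/
private theorem isQuadratic_legendre (p : ℕ) [Fact p.Prime] :
    ((quadraticChar (ZMod p)).ringHomComp (Int.castRingHom ℂ)).IsQuadratic :=
  (quadraticChar_isQuadratic (ZMod p)).comp _

/-- For `D ≥ 3` and large, the family `Ψ` is non-empty: the window `p ∼ P` contains a prime
(`Skeleton.frakP_eventually_pos`), that prime exceeds `P = e^{𝓛⁹} > 2`, and the Legendre character
mod it is primitive. [cite: Zhang2022LandauSiegel, §2 (2.9)] -/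
private theorem exists_chr : ∃ D₁ : ℕ, ∀ D : ℕ, D₁ ≤ D → Nonempty (Chr D) := by
  obtain ⟨D₁, h⟩ := Skeleton.frakP_eventually_pos
  refine ⟨max D₁ 3, fun D hD => ?_⟩
  have hD₁ : D₁ ≤ D := le_trans (le_max_left _ _) hD
  have hD3 : 3 ≤ D := le_trans (le_max_right _ _) hD
  have hpos := h D hD₁
  rw [frakP_eq_sum_primeWindow] at hpos
  obtain ⟨p, hp⟩ : (primeWindow D).Nonempty := by
    by_contra hne
    rw [Finset.not_nonempty_iff_eq_empty] at hne
    rw [hne, Finset.sum_empty] at hpos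
    exact lt_irrefl _ hpos
  have hp' := hp
  rw [primeWindow, Finset.mem_filter, Finset.mem_Ioo] at hp'
  obtain ⟨⟨h1, -⟩, hprime⟩ := hp'
  haveI : Fact p.Prime := ⟨hprime⟩
  have hP : Real.exp 1 ≤ bigP D := by
    rw [bigP]; exact Real.exp_le_exp.mpr (one_le_pow₀ (one_le_ell hD3))
  have hPp : bigP D < p := (Nat.floor_lt (Real.exp_pos _).le).mp h1
  have hp2 : p ≠ 2 := by
    intro h2
    rw [h2] at hPp
    have he : (2 : ℝ) < Real.exp 1 := by have := Real.add_one_le_exp (1 : ℝ); linarith [Real.exp_one_gt_d9]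
    push_cast at hPp
    linarith
  exact ⟨⟨p, hp, (quadraticChar (ZMod p)).ringHomComp (Int.castRingHom ℂ), isPrimitive_legendre hp2⟩⟩

/-- `log(1 + y) ≥ y/2` for `0 ≤ y ≤ 1`. [folklore] -/
private theorem half_le_log_one_add {y : ℝ} (hy0 : 0 ≤ y) (hy1 : y ≤ 1) :
    y / 2 ≤ Real.log (1 + y) := by
  have h := Real.one_sub_inv_le_log_of_pos (show 0 < 1 + y by linarith)
  have e : 1 - (1 + y)⁻¹ = y / (1 + y) := by field_simp; ring
  rw [e] at h
  have h2 : y / 2 ≤ y / (1 + y) := by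
    rw [div_le_div_iff₀ (by norm_num) (by linarith)]; nlinarith
  linarith

/-- **`¬ Sec5_u002b` — the AS-PRINTED `§5.u002` (second equality, `t = Im s`, absolute constant,
uniformly in `|w′| < 𝓛²⁰`) is FALSE** (kernel certificate for GAP row G-L1t8-1, class
printed-false-pointwise). Witness: `D` prime with `χ = (·/D) ⊗ ℂ`, any `ψ ∈ Ψ` (non-empty by
`exists_chr`), `s = s₀ = 1/2 + 2πit₀`, `v′ = 𝓛²⁰/2`; then the Stirling step (`norm_logDeriv_Zfac_add_log_le`)
gives `‖(Z′/Z)(s+iv′) + log(pt/2π)‖ ≥ log(1 + 𝓛²⁰/(4πt₀)) − 12/t₀ ≥ 𝓛²⁰/(8πt₀) − 12/t₀`, which beats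
`C/t₀` once `𝓛²⁰ > 8π(C + 12)`. The corrected reading `Sec5_u002b'` holds (`sec5_u002b'_holds`).
[cite: Zhang2022LandauSiegel, §5.u002 p.24] -/
theorem not_sec5_u002b : ¬ Sec5_u002b := by
  rintro ⟨C, D₀, hAll⟩
  obtain ⟨D₁, hchr⟩ := exists_chr
  -- a prime modulus `q` beyond every threshold, with `𝓛 = log q ≥ A`
  set A : ℝ := 8 * π * (|C| + 12) + 9 with hA
  have hA9 : (9 : ℝ) ≤ A := by have := abs_nonneg C; nlinarith [Real.pi_gt_three]
  obtain ⟨q, hqge, hq⟩ := Nat.exists_infinite_primes (max (max D₀ D₁) (⌈Real.exp A⌉₊ + 1))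
  haveI : Fact q.Prime := ⟨hq⟩
  haveI : NeZero q := ⟨hq.ne_zero⟩
  have hqD₀ : D₀ ≤ q := le_trans (le_trans (le_max_left _ _) (le_max_left _ _)) hqge
  have hqD₁ : D₁ ≤ q := le_trans (le_trans (le_max_right _ _) (le_max_left _ _)) hqge
  have hqreal : Real.exp A < (q : ℝ) := by
    have h1 : (⌈Real.exp A⌉₊ + 1 : ℕ) ≤ q := le_trans (le_max_right _ _) hqge
    have h2 : Real.exp A ≤ (⌈Real.exp A⌉₊ : ℝ) := Nat.le_ceil _
    have h3 : ((⌈Real.exp A⌉₊ + 1 : ℕ) : ℝ) ≤ (q : ℝ) := by exact_mod_cast h1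
    push_cast at h3
    linarith
  have hLA : A ≤ ell q := by
    rw [ell]
    calc A = Real.log (Real.exp A) := (Real.log_exp A).symm
      _ ≤ Real.log q := Real.log_le_log (Real.exp_pos A) hqreal.le
  have hL9r : (9 : ℝ) ≤ ell q := hA9.trans hLA
  have hq9 : 9 ≤ q := by
    by_contra h
    have h8 : (q : ℝ) ≤ 8 := by exact_mod_cast (by omega : q ≤ 8)
    have : ell q ≤ 8 := by
      rw [ell]
      calc Real.log q ≤ (q : ℝ) - 1 := Real.log_le_sub_one_of_pos (by exact_mod_cast hq.pos)
        _ ≤ 8 := by linarith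
    linarith
  have hq2 : q ≠ 2 := by omega
  have hL2 := two_le_ell' hq9
  have hL1 : 1 ≤ ell q := by linarith
  have hL0 : 0 < ell q := by linarith
  obtain ⟨hα0, -⟩ := alpha_small hL2
  -- the instantiated printed claim
  have hbody := hAll q ((quadraticChar (ZMod q)).ringHomComp (Int.castRingHom ℂ)) hqD₀
    (isQuadratic_legendre q) (isPrimitive_legendre hq2)
  obtain ⟨x⟩ := hchr q hqD₁
  set s : ℂ := 1 / 2 + 2 * π * t0 q * I with hs
  have hsre : s.re = 1 / 2 := by simp [hs]
  have hsim : s.im = 2 * π * t0 q := by simp [hs]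
  have hIn : InRange51 q s := by
    refine ⟨?_, ?_⟩
    · rw [hsre]; simp [hα0.le]
    · rw [hsim, sub_self, abs_zero]; have : (0:ℝ) ≤ ell1 q := pow_nonneg hL0.le _; linarith
  set v' : ℝ := ell q ^ 20 / 2 with hv'
  have h20pos : 0 < ell q ^ 20 := by positivity
  have hv'abs : |v'| < ell q ^ 20 := by rw [hv', abs_of_pos (by positivity)]; linarith
  have hb := hbody x s hIn v' hv'abs
  -- Stirling at `z = s + iv′`
  set z : ℂ := s + v' * I with hz
  have hzre : z.re = 1 / 2 := by simp [hz, hs]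
  have hzim : z.im = 2 * π * t0 q + v' := by simp [hz, hs]
  have ht0 : t0 q = ell q ^ 519 := rfl
  have h519 : (1 : ℝ) ≤ ell q ^ 519 := one_le_pow₀ hL1
  have ht0pos : 0 < t0 q := by rw [ht0]; linarith
  have hπ3 : (3 : ℝ) < π := Real.pi_gt_three
  have hzim_ge : ell q ^ 519 ≤ z.im := by
    rw [hzim, ht0]; have : 0 ≤ v' := by positivity
    nlinarith
  have hzim_pos : 0 < z.im := by linarith
  have hst := norm_logDeriv_Zfac_add_log_le hq9 x (z := z) (by rw [hzre]; norm_num)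
    (by rw [hzre]; norm_num) hzim_ge
  -- the two logs differ by `log(1 + v′/(2πt₀))`
  have hp0 : (0 : ℝ) < x.p := by exact_mod_cast x.prime.pos
  set y : ℝ := v' / (2 * π * t0 q) with hy
  have hy0 : 0 ≤ y := by positivity
  have hy1 : y ≤ 1 := by
    rw [hy, div_le_one (by positivity), hv', ht0]
    have h20 : ell q ^ 20 ≤ ell q ^ 519 := pow_le_pow_right₀ hL1 (by norm_num)
    nlinarith
  have hlogz : Real.log (z.im / (2 * π)) = Real.log (t0 q) + Real.log (1 + y) := by
    have e : z.im / (2 * π) = t0 q * (1 + y) := by rw [hzim, hy]; field_simp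
    rw [e, Real.log_mul ht0pos.ne' (by linarith)]
  have hlogs : Real.log (x.p * s.im / (2 * π)) = Real.log x.p + Real.log (t0 q) := by
    have e : (x.p : ℝ) * s.im / (2 * π) = x.p * t0 q := by rw [hsim]; field_simp
    rw [e, Real.log_mul hp0.ne' ht0pos.ne']
  have ediff : (logDeriv (GammaFactor.Zfac x.ψ) z + Real.log x.p + Real.log (z.im / (2 * π))) -
      (logDeriv (GammaFactor.Zfac x.ψ) z + (Real.log (x.p * s.im / (2 * π)) : ℂ)) =
      (Real.log (1 + y) : ℂ) := by
    rw [hlogz, hlogs]; push_cast; ring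
  have hlog_le : Real.log (1 + y) ≤ 12 / z.im + C * (t0 q)⁻¹ := by
    have h1 : ‖(Real.log (1 + y) : ℂ)‖ ≤ ‖logDeriv (GammaFactor.Zfac x.ψ) z + Real.log x.p +
        Real.log (z.im / (2 * π))‖ + ‖logDeriv (GammaFactor.Zfac x.ψ) z +
        (Real.log (x.p * s.im / (2 * π)) : ℂ)‖ := by
      rw [← ediff]; exact norm_sub_le _ _
    rw [Complex.norm_real, Real.norm_eq_abs, abs_of_nonneg (Real.log_nonneg (by linarith))] at h1
    exact h1.trans (add_le_add hst hb)
  -- lower bound `log(1+y) ≥ y/2 = 𝓛²⁰/(8πt₀)` and `12/Im z ≤ 12/t₀`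
  have hlow := half_le_log_one_add hy0 hy1
  have h12 : 12 / z.im ≤ 12 / t0 q :=
    div_le_div_of_nonneg_left (by norm_num) ht0pos (by rw [ht0]; exact hzim_ge)
  have key : y / 2 ≤ (12 + C) / t0 q := by
    have : 12 / t0 q + C * (t0 q)⁻¹ = (12 + C) / t0 q := by rw [div_eq_mul_inv, div_eq_mul_inv]; ring
    linarith
  -- i.e. `𝓛²⁰ ≤ 8π(12 + C)`, contradicting `𝓛 ≥ A`
  have key' : ell q ^ 20 ≤ 8 * π * (12 + C) := by
    rw [hy, hv'] at key
    rw [div_div, div_le_div_iff₀ (by positivity) ht0pos] at key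
    nlinarith [ht0pos]
  have h20 : ell q ≤ ell q ^ 20 := by
    calc ell q = ell q ^ 1 := (pow_one _).symm
      _ ≤ ell q ^ 20 := pow_le_pow_right₀ hL1 (by norm_num)
  have hC : C ≤ |C| := le_abs_self C
  nlinarith [Real.pi_pos]

/-! ## Kernel certificate for GAP row G-L1t8-1, second half: the AS-PRINTED `§5.u003` is false

Witness as for `not_sec5_u002b` (`D` prime, `χ` the Legendre character, `ψ ∈ Ψ`, `s = s₀`,
`v = 𝓛²⁰/2`). Writing `Z(s+iv) = Z(s)·exp(i∫₀^v (Z′/Z)(s+iy)dy)` (tree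
`eq_mul_exp_I_mul_integral_logDeriv`) and using the Stirling step pointwise,
`i∫₀^v (Z′/Z)(s+iy)dy = −iv·log(pt/2π) − iΦ + iR`, `Φ = ∫₀^v log(1+y/t)dy ≥ v²/(4t)`, `‖R‖ ≤ 12v/t`; since
`|Z(s₀)| = 1` and `|e^w − 1| ≥ ‖w‖ − ‖w‖²`, the discrepancy is `≥ (Φ − ‖R‖)/2 ≍ 𝓛⁴⁰/t₀`, against the
claimed `O(|v|/t₀) = O(𝓛²⁰/t₀)`. The corrected reading `Sec5_u003'` holds (`sec5_u003'_holds`). -/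

/-- `Z′/Z` is continuous along a vertical segment in the upper half-plane (`Z` analytic and zero-free
there). [cite: Zhang2022LandauSiegel, §5 Lemma 5.1 (proof) p.24] -/
private theorem continuousOn_logDeriv_Zfac_segment {k : ℕ} [NeZero k] {θ : DirichletCharacter ℂ k}
    (hθ : θ.IsPrimitive) {s : ℂ} {a b : ℝ} (hseg : ∀ y ∈ Set.Icc a b, 0 < (s + (y : ℂ) * I).im) :
    ContinuousOn (fun y : ℝ => deriv (GammaFactor.Zfac θ) (s + (y : ℂ) * I) /
      GammaFactor.Zfac θ (s + (y : ℂ) * I)) (Set.Icc a b) := by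
  have ho : IsOpen {z : ℂ | 0 < z.im} := isOpen_lt continuous_const Complex.continuous_im
  have han : AnalyticOnNhd ℂ (GammaFactor.Zfac θ) {z : ℂ | 0 < z.im} :=
    fun z hz => GammaFactor.analyticAt_Zfac θ hz
  have h1 : ContinuousOn (deriv (GammaFactor.Zfac θ)) {z : ℂ | 0 < z.im} := han.deriv.continuousOn
  have h2 : ContinuousOn (GammaFactor.Zfac θ) {z : ℂ | 0 < z.im} := han.continuousOn
  have hq : ContinuousOn (fun z => deriv (GammaFactor.Zfac θ) z / GammaFactor.Zfac θ z)
      {z : ℂ | 0 < z.im} := h1.div h2 fun z hz => GammaFactor.Zfac_ne_zero hθ hz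
  have hg : Continuous fun y : ℝ => s + (y : ℂ) * I := by fun_prop
  exact hq.comp hg.continuousOn fun y hy => hseg y hy

set_option maxHeartbeats 400000 in
/-- **`¬ Sec5_u003` — the AS-PRINTED `§5.u003` ("`Z(s+w,ψ) = Z(s,ψ)(pt/2π)^{−w} + O(|w|/t₀)`" with
`t = Im s` and an absolute constant, uniformly in `|w| < 𝓛²⁰`) is FALSE** (kernel certificate for GAP
row G-L1t8-1, class printed-false-pointwise; the corrected reading `Sec5_u003'` is proved above).
[cite: Zhang2022LandauSiegel, §5.u003 p.24] -/
theorem not_sec5_u003 : ¬ Sec5_u003 := by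
  rintro ⟨C, D₀, hAll⟩
  obtain ⟨D₁, hchr⟩ := exists_chr
  set A : ℝ := 40 * π * (|C| + 4) + 9 with hA
  have hA9 : (9 : ℝ) ≤ A := by have := abs_nonneg C; nlinarith [Real.pi_gt_three]
  obtain ⟨q, hqge, hq⟩ := Nat.exists_infinite_primes (max (max D₀ D₁) (⌈Real.exp A⌉₊ + 1))
  haveI : Fact q.Prime := ⟨hq⟩
  haveI : NeZero q := ⟨hq.ne_zero⟩
  have hqD₀ : D₀ ≤ q := le_trans (le_trans (le_max_left _ _) (le_max_left _ _)) hqge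
  have hqD₁ : D₁ ≤ q := le_trans (le_trans (le_max_right _ _) (le_max_left _ _)) hqge
  have hqreal : Real.exp A < (q : ℝ) := by
    have h1 : (⌈Real.exp A⌉₊ + 1 : ℕ) ≤ q := le_trans (le_max_right _ _) hqge
    have h2 : Real.exp A ≤ (⌈Real.exp A⌉₊ : ℝ) := Nat.le_ceil _
    have h3 : ((⌈Real.exp A⌉₊ + 1 : ℕ) : ℝ) ≤ (q : ℝ) := by exact_mod_cast h1
    push_cast at h3
    linarith
  have hLA : A ≤ ell q := by
    rw [ell]
    calc A = Real.log (Real.exp A) := (Real.log_exp A).symm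
      _ ≤ Real.log q := Real.log_le_log (Real.exp_pos A) hqreal.le
  have hL9r : (9 : ℝ) ≤ ell q := hA9.trans hLA
  have hq9 : 9 ≤ q := by
    by_contra h
    have h8 : (q : ℝ) ≤ 8 := by exact_mod_cast (by omega : q ≤ 8)
    have : ell q ≤ 8 := by
      rw [ell]
      calc Real.log q ≤ (q : ℝ) - 1 := Real.log_le_sub_one_of_pos (by exact_mod_cast hq.pos)
        _ ≤ 8 := by linarith
    linarith
  have hq2 : q ≠ 2 := by omega
  have hL2 := two_le_ell' hq9
  have hL1 : 1 ≤ ell q := by linarith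
  have hL0 : 0 < ell q := by linarith
  obtain ⟨hα0, -⟩ := alpha_small hL2
  have hbody := hAll q ((quadraticChar (ZMod q)).ringHomComp (Int.castRingHom ℂ)) hqD₀
    (isQuadratic_legendre q) (isPrimitive_legendre hq2)
  obtain ⟨x⟩ := hchr q hqD₁
  -- the witness point and shift
  set t : ℝ := 2 * π * t0 q with htdef
  set s : ℂ := 1 / 2 + (t : ℂ) * I with hs
  have hsre : s.re = 1 / 2 := by simp [hs]
  have hsim : s.im = t := by simp [hs]
  have ht0 : t0 q = ell q ^ 519 := rfl
  have h519 : (1 : ℝ) ≤ ell q ^ 519 := one_le_pow₀ hL1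
  have ht0pos : 0 < t0 q := by rw [ht0]; linarith
  have hπ3 : (3 : ℝ) < π := Real.pi_gt_three
  have htpos : 0 < t := by rw [htdef]; positivity
  have htge : ell q ^ 519 ≤ t := by rw [htdef, ht0]; nlinarith
  have hIn : InRange51 q s := by
    constructor
    · rw [hsre]; simp [hα0.le]
    · have h0 : s.im - 2 * π * t0 q = 0 := by rw [hsim, htdef]; ring
      have h1 : (0 : ℝ) ≤ ell1 q := pow_nonneg hL0.le _
      rw [h0, abs_zero]; linarith
  set v : ℝ := ell q ^ 20 / 2 with hv
  have hvpos : 0 < v := by positivity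
  have h20pos : 0 < ell q ^ 20 := by positivity
  have hvabs : |v| < ell q ^ 20 := by rw [abs_of_pos hvpos, hv]; linarith
  have hvt : v < t := by
    have h20 : ell q ^ 20 ≤ ell q ^ 519 := pow_le_pow_right₀ hL1 (by norm_num)
    rw [hv]; linarith
  have hb := hbody x s hIn v hvabs
  rw [hsim] at hb
  -- `Z(s+iv) = Z(s)·exp(i∫₀^v f)`, `f(y) = (Z′/Z)(s+iy)`
  set f : ℝ → ℂ := fun y => deriv (GammaFactor.Zfac x.ψ) (s + (y : ℂ) * I) /
    GammaFactor.Zfac x.ψ (s + (y : ℂ) * I) with hf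
  have hseg : ∀ y ∈ Set.Icc (0 : ℝ) v, 0 < (s + (y : ℂ) * I).im := by
    intro y hy; simp [hs]; linarith [hy.1]
  have hseg' : ∀ y ∈ Set.Icc (-|v|) (|v|), 0 < (s + (y : ℂ) * I).im := by
    intro y hy
    have : -v ≤ y := by rw [abs_of_pos hvpos] at hy; exact hy.1
    simp [hs]; linarith
  have hg : ∀ y ∈ Set.Icc (-|v|) (|v|), AnalyticAt ℂ (GammaFactor.Zfac x.ψ) (s + y * I) :=
    fun y hy => GammaFactor.analyticAt_Zfac x.ψ (hseg' y hy)
  have h0 : ∀ y ∈ Set.Icc (-|v|) (|v|), GammaFactor.Zfac x.ψ (s + y * I) ≠ 0 :=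
    fun y hy => GammaFactor.Zfac_ne_zero x.prim (hseg' y hy)
  have hp0mem : (0 : ℝ) ∈ Set.Icc (-|v|) (|v|) := ⟨by simp, by simp⟩
  have hvmem : v ∈ Set.Icc (-|v|) (|v|) := ⟨neg_abs_le v, le_abs_self v⟩
  have hZeq := eq_mul_exp_I_mul_integral_logDeriv hg h0 hp0mem hvmem
  simp only [ofReal_zero, zero_mul, add_zero] at hZeq
  -- pointwise Stirling: `f(y) + log(pt/2π) = −log(1 + y/t) + r(y)`, `‖r(y)‖ ≤ 12/t`
  have hp0 : (0 : ℝ) < x.p := by exact_mod_cast x.prime.pos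
  set Lpt : ℝ := Real.log (x.p * t / (2 * π)) with hLpt
  set r : ℝ → ℂ := fun y => f y + Lpt + Real.log (1 + y / t) with hr
  have hr_bound : ∀ y ∈ Set.Icc (0 : ℝ) v, ‖r y‖ ≤ 12 / t := by
    intro y hy
    have hzim : (s + (y : ℂ) * I).im = t + y := by simp [hs]
    have him : ell q ^ 519 ≤ (s + (y : ℂ) * I).im := by rw [hzim]; linarith [hy.1]
    have hst := norm_logDeriv_Zfac_add_log_le hq9 x (z := s + (y : ℂ) * I) (by simp [hs])
      (by simp [hs]; norm_num) him
    rw [logDeriv_apply, hzim] at hst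
    have hlog : Real.log ((t + y) / (2 * π)) = Lpt - Real.log x.p + Real.log (1 + y / t) := by
      have e1 : (t + y) / (2 * π) = (t / (2 * π)) * (1 + y / t) := by field_simp
      have e2 : Lpt = Real.log x.p + Real.log (t / (2 * π)) := by
        rw [hLpt, mul_div_assoc, Real.log_mul hp0.ne' (by positivity)]
      rw [e1, Real.log_mul (by positivity) (by linarith [div_nonneg hy.1 htpos.le]), e2]; ring
    have e : r y = deriv (GammaFactor.Zfac x.ψ) (s + (y : ℂ) * I) / GammaFactor.Zfac x.ψ (s + (y : ℂ) * I)
        + Real.log x.p + Real.log ((t + y) / (2 * π)) := by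
      rw [hr, hf, hlog]; push_cast; ring
    rw [e]
    refine hst.trans (div_le_div_of_nonneg_left (by norm_num) htpos (by linarith [hy.1]))
  -- integrability on `[0, v]`
  have hfint : IntervalIntegrable f MeasureTheory.volume 0 v :=
    (continuousOn_logDeriv_Zfac_segment x.prim hseg).intervalIntegrable_of_Icc hvpos.le
  have hlogint : IntervalIntegrable (fun y : ℝ => ((Real.log (1 + y / t) : ℝ) : ℂ))
      MeasureTheory.volume 0 v := by
    refine (ContinuousOn.intervalIntegrable_of_Icc hvpos.le ?_)
    refine Complex.continuous_ofReal.comp_continuousOn ?_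
    refine ContinuousOn.log (by fun_prop) fun y hy => ?_
    have : 0 ≤ y / t := div_nonneg hy.1 htpos.le
    linarith
  have hrint : IntervalIntegrable r MeasureTheory.volume 0 v := by
    rw [hr]; exact (hfint.add intervalIntegrable_const).add hlogint
  -- `Φ` and `R`
  set Φ : ℝ := ∫ y in (0 : ℝ)..v, Real.log (1 + y / t) with hΦ
  set R : ℂ := ∫ y in (0 : ℝ)..v, r y with hR
  have hΦC : (∫ y in (0 : ℝ)..v, ((Real.log (1 + y / t) : ℝ) : ℂ)) = (Φ : ℂ) := by
    rw [hΦ, intervalIntegral.integral_ofReal]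
  have hint_f : (∫ y in (0 : ℝ)..v, f y) = R - v * (Lpt : ℂ) - (Φ : ℂ) := by
    have e : (fun y => f y) = fun y => r y - (Lpt : ℂ) - ((Real.log (1 + y / t) : ℝ) : ℂ) := by
      funext y; rw [hr]; ring
    rw [e, intervalIntegral.integral_sub (hrint.sub intervalIntegrable_const) hlogint,
      intervalIntegral.integral_sub hrint intervalIntegrable_const, intervalIntegral.integral_const,
      hΦC, ← hR, sub_zero, Complex.real_smul]
  -- bounds on `Φ` and `R`
  have hΦ_lower : v ^ 2 / (4 * t) ≤ Φ := by
    have h1 : (∫ y in (0 : ℝ)..v, y / (2 * t)) ≤ Φ := by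
      rw [hΦ]
      refine intervalIntegral.integral_mono_on hvpos.le
        ((by fun_prop : Continuous fun y : ℝ => y / (2 * t)).intervalIntegrable _ _) ?_ fun y hy => ?_
      · refine ContinuousOn.intervalIntegrable_of_Icc hvpos.le (ContinuousOn.log (by fun_prop) fun y hy => ?_)
        have : 0 ≤ y / t := div_nonneg hy.1 htpos.le
        linarith
      · have hy1 : y / t ≤ 1 := by rw [div_le_one htpos]; linarith [hy.2]
        have := half_le_log_one_add (div_nonneg hy.1 htpos.le) hy1
        calc y / (2 * t) = y / t / 2 := by ring
          _ ≤ Real.log (1 + y / t) := this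
    have h2 : (∫ y in (0 : ℝ)..v, y / (2 * t)) = v ^ 2 / (4 * t) := by
      have : (fun y : ℝ => y / (2 * t)) = fun y => y * (1 / (2 * t)) := by funext y; ring
      rw [this, intervalIntegral.integral_mul_const, integral_id]; ring
    linarith
  have hΦ_upper : Φ ≤ v ^ 2 / (2 * t) := by
    have h1 : Φ ≤ ∫ y in (0 : ℝ)..v, y / t := by
      rw [hΦ]
      refine intervalIntegral.integral_mono_on hvpos.le ?_
        ((by fun_prop : Continuous fun y : ℝ => y / t).intervalIntegrable _ _) fun y hy => ?_
      · refine ContinuousOn.intervalIntegrable_of_Icc hvpos.le (ContinuousOn.log (by fun_prop) fun y hy => ?_)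
        have : 0 ≤ y / t := div_nonneg hy.1 htpos.le
        linarith
      · have : 0 ≤ y / t := div_nonneg hy.1 htpos.le
        have := Real.log_le_sub_one_of_pos (show 0 < 1 + y / t by linarith)
        linarith
    have h2 : (∫ y in (0 : ℝ)..v, y / t) = v ^ 2 / (2 * t) := by
      have : (fun y : ℝ => y / t) = fun y => y * (1 / t) := by funext y; ring
      rw [this, intervalIntegral.integral_mul_const, integral_id]; ring
    linarith
  have hΦ0 : 0 ≤ Φ := le_trans (by positivity) hΦ_lower
  have hR_bound : ‖R‖ ≤ 12 / t * v := by
    have h := intervalIntegral.norm_integral_le_of_norm_le_const (a := (0:ℝ)) (b := v) (f := r)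
      (C := 12 / t) fun y hy => hr_bound y (by
        rw [Set.uIoc_of_le hvpos.le] at hy; exact ⟨hy.1.le, hy.2⟩)
    rw [← hR] at h
    simpa [abs_of_pos hvpos] using h
  -- sizes: `v²/(4t) = 𝓛⁴⁰/(32πt₀)`; `12v/t`; `w := i(R − Φ)` has `Φ − 12v/t ≤ ‖w‖ ≤ Φ + 12v/t ≤ 1/2`
  have hv2t : v ^ 2 / (2 * t) ≤ 1 / 4 := by
    rw [div_le_iff₀ (by positivity), hv]
    have h40 : ell q ^ 20 * ell q ^ 20 ≤ ell q ^ 519 := by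
      calc ell q ^ 20 * ell q ^ 20 = ell q ^ 40 := by ring
        _ ≤ ell q ^ 519 := pow_le_pow_right₀ hL1 (by norm_num)
    nlinarith
  have h12vt : 12 / t * v ≤ 1 / 4 := by
    rw [div_mul_eq_mul_div, div_le_iff₀ htpos, hv]
    have h25 : 24 * ell q ^ 20 ≤ ell q ^ 519 := by
      calc 24 * ell q ^ 20 ≤ ell q ^ 5 * ell q ^ 20 := by
            refine mul_le_mul_of_nonneg_right ?_ (by positivity)
            calc (24 : ℝ) ≤ 2 ^ 5 := by norm_num
              _ ≤ ell q ^ 5 := pow_le_pow_left₀ (by norm_num) hL2 5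
        _ = ell q ^ 25 := by ring
        _ ≤ ell q ^ 519 := pow_le_pow_right₀ hL1 (by norm_num)
    nlinarith
  set w : ℂ := I * (R - (Φ : ℂ)) with hw
  have hw_norm : ‖w‖ = ‖R - (Φ : ℂ)‖ := by rw [hw, norm_mul, Complex.norm_I, one_mul]
  have hw_upper : ‖w‖ ≤ 1 / 2 := by
    rw [hw_norm]
    calc ‖R - (Φ : ℂ)‖ ≤ ‖R‖ + ‖(Φ : ℂ)‖ := norm_sub_le _ _
      _ ≤ 12 / t * v + Φ := by rw [Complex.norm_real, Real.norm_eq_abs, abs_of_nonneg hΦ0]; linarith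
      _ ≤ 1 / 2 := by linarith
  have hw_lower : Φ - 12 / t * v ≤ ‖w‖ := by
    rw [hw_norm]
    have h := norm_sub_norm_le (Φ : ℂ) R
    rw [Complex.norm_real, Real.norm_eq_abs, abs_of_nonneg hΦ0, norm_sub_rev] at h
    linarith
  -- `Z(s+iv) − Z(s)(pt/2π)^{−iv} = Z(s)·(pt/2π)^{−iv}·(e^{w} − 1)`
  have hqpos : 0 < (x.p : ℝ) * t / (2 * π) := by positivity
  have hcpow : ((((x.p : ℝ) * t / (2 * π) : ℝ)) : ℂ) ^ (-(v * I)) =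
      Complex.exp (-((v : ℂ) * (Lpt : ℂ)) * I) := by
    rw [Complex.cpow_def_of_ne_zero (by exact_mod_cast hqpos.ne'), ← Complex.ofReal_log hqpos.le, hLpt]
    congr 1; ring
  have hexp_split : Complex.exp (I * ∫ y in (0 : ℝ)..v, f y) =
      Complex.exp (-((v : ℂ) * (Lpt : ℂ)) * I) * Complex.exp w := by
    rw [hint_f, ← Complex.exp_add]; congr 1; rw [hw]; ring
  have hdiff : GammaFactor.Zfac x.ψ (s + v * I) -
      GammaFactor.Zfac x.ψ s * ((((x.p : ℝ) * t / (2 * π) : ℝ)) : ℂ) ^ (-(v * I)) =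
      GammaFactor.Zfac x.ψ s * Complex.exp (-((v : ℂ) * (Lpt : ℂ)) * I) * (Complex.exp w - 1) := by
    rw [hZeq, hcpow]
    simp only [hf] at hexp_split ⊢
    rw [hexp_split]; ring
  -- norms: `|Z(s₀)| = 1`, `|e^{−ivL}| = 1`, `|e^w − 1| ≥ ‖w‖ − ‖w‖²`
  have hZ1 : ‖GammaFactor.Zfac x.ψ s‖ = 1 := by
    rw [hs]; exact GammaFactor.norm_Zfac_half_eq_one x.prim htpos
  have hE1 : ‖Complex.exp (-((v : ℂ) * (Lpt : ℂ)) * I)‖ = 1 := by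
    have : -((v : ℂ) * (Lpt : ℂ)) * I = ((-(v * Lpt) : ℝ) : ℂ) * I := by push_cast; ring
    rw [this, Complex.norm_exp_ofReal_mul_I]
  have hexp_lower : ‖w‖ - ‖w‖ ^ 2 ≤ ‖Complex.exp w - 1‖ := by
    have h := Complex.norm_exp_sub_one_sub_id_le (x := w) (by linarith)
    have h2 : ‖w‖ ≤ ‖Complex.exp w - 1‖ + ‖Complex.exp w - 1 - w‖ := by
      have := norm_sub_le (Complex.exp w - 1) (Complex.exp w - 1 - w)
      have e2 : Complex.exp w - 1 - (Complex.exp w - 1 - w) = w := by ring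
      rwa [e2] at this
    linarith
  have hLHS : ‖w‖ / 2 ≤ ‖GammaFactor.Zfac x.ψ (s + v * I) -
      GammaFactor.Zfac x.ψ s * ((((x.p : ℝ) * t / (2 * π) : ℝ)) : ℂ) ^ (-(v * I))‖ := by
    have hn : ‖GammaFactor.Zfac x.ψ s * Complex.exp (-((v : ℂ) * (Lpt : ℂ)) * I) *
        (Complex.exp w - 1)‖ = ‖Complex.exp w - 1‖ := by
      rw [norm_mul, norm_mul, hZ1, hE1, one_mul, one_mul]
    rw [hdiff, hn]
    have hwn := norm_nonneg w
    have hsq : ‖w‖ ^ 2 ≤ ‖w‖ * (1 / 2) := by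
      rw [pow_two]; exact mul_le_mul_of_nonneg_left hw_upper hwn
    linarith
  -- combine with the printed bound `≤ C|v|/t₀`
  have hfinal : ‖w‖ / 2 ≤ C * |v| * (t0 q)⁻¹ := hLHS.trans hb
  rw [abs_of_pos hvpos] at hfinal
  -- `‖w‖ ≥ v²/(4t) − 12v/t`, so `v²/(8t) − 6v/t ≤ C v/t₀`, `t = 2πt₀`: `v/(16π) − 12/(2π)… ≤ C`
  have key : v ^ 2 / (4 * t) - 12 / t * v ≤ 2 * (C * v * (t0 q)⁻¹) := by linarith
  have ht0t : (t0 q)⁻¹ = 2 * π / t := by rw [htdef]; field_simp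
  rw [ht0t] at key
  -- multiply through by `t/v > 0`: `v/4 − 12 ≤ 4πC`
  have key2 : v / 4 - 12 ≤ 4 * π * C := by
    have e1 : v ^ 2 / (4 * t) - 12 / t * v = (v / t) * (v / 4 - 12) := by ring
    have e2 : 2 * (C * v * (2 * π / t)) = (v / t) * (4 * π * C) := by ring
    rw [e1, e2] at key
    exact le_of_mul_le_mul_left key (div_pos hvpos htpos)
  rw [hv] at key2
  have h20 : ell q ≤ ell q ^ 20 := by
    calc ell q = ell q ^ 1 := (pow_one _).symm
      _ ≤ ell q ^ 20 := pow_le_pow_right₀ hL1 (by norm_num)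
  have hC : C ≤ |C| := le_abs_self C
  have hπC : π * C ≤ π * |C| := mul_le_mul_of_nonneg_left hC Real.pi_pos.le
  have hw0 : 0 ≤ π * |C| := mul_nonneg Real.pi_pos.le (abs_nonneg C)
  nlinarith [hπC, hw0, Real.pi_gt_three, hLA, h20, key2, hA]

end Literature.NumberTheory.LFunctions.Zhang2022.Typed
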